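import Literature.MathematicalPhysics.QuantumFieldTheory.Balaban1983to89.BlockAveraging
import Literature.MathematicalPhysics.QuantumFieldTheory.Balaban1983to89.B7BlockAvgLog
import Literature.MathematicalPhysics.QuantumLattice.BalabanBlockAverage
import Literature.Analysis.Matrix.DetExp

/-!
# The PRINTED small-loop average of [Balaban1987RG1] (0.4) — `{W_i} ↦ exp[i Σ_i |I|⁻¹ (1/i) log W_i]` — as an
# inhabitant of `LoopAverage U(N)` and of `LoopAverage SU(N)`, with (0.5)–(0.7), (0.9) and the exact form of (0.8)
# kernel-checked, and the measurability hypothesis of `BlockAveraging` discharged — v1.1: + ANALYTICITY and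
# `Gᶜ`-valuedness of the printed operation (§7)

Cell `pub-balaban`, T4 programme row T4-D.L-EML* (kind TYPE; node D / O1-H1 of the DAG), discharging the cell objections
G-adv2-25 REPAIR (i) and G-pv11g5-2 follow-up (i): the tree's `LoopAverage G` (`BlockAveraging` §0) AXIOMATISES the
operation inside (0.4) by the paper's (0.5)–(0.7) and is inhabited in the tree only by `E ≡ 1` (`LoopAverage.trivial`), by
abstract `GroupAverage`s, and on `SU(2)` by the quaternionic projected mean (`BlockAveragingSU2.su2Mean`) — none of which is
the operation (0.4) PRINTS.  This module types the printed operation itself on the matrix groups `U(N)`, `SU(N)` of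
`UnitaryModel` and proves what the axioms ask of it.

CITATION HEADER (lean-in-tree rule 2026-08-18).  T. Bałaban, *Renormalization group approach to lattice gauge field
theories. I. Generation of effective actions in a small field approximation and a coupling constant renormalization in
four dimensions*, Comm. Math. Phys. **109**, 249–301 (1987) [Balaban1987RG1] (cell paper B12), p. 253, quoted from the
page render `…1987-cmp109-rg-I-small-field-p005-x2.png`, re-read as an image by the filing unit on 2026-08-18:
* (0.4) p. 253: "Ū(c) = M(U, c) = exp[ i Σ_{x∈B(c₋)} L^{-d} Σ_{Γ∈G(c₋,x)} 1/|G(c₋,x)| Σ_{Γ′∈G(c₊,x′)} 1/|G(c₊,x′)| ×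
  (1/i) log U(Γ ∪ [x,x′] ∪ (−Γ′) ∪ (−c)) ] U(c)."
* p. 253: "Thus we have to define an average of a finite set of group elements. We introduce an axiomatric definition
  of such an average. It is a Gᶜ-valued function defined on sets {U_j : j = 1, 2, …, n}, U_j ∈ Gᶜ, with sufficiently
  small diameters. We denote it by {U_j}‾ = M({U_j}), and we assume that it is an analytic function having the following
  properties: M({U_j⁻¹}) = M({U_j})⁻¹; (0.5) M({uU_jv}) = uM({U_j})v; (0.6) M(π{U_j}) = M({U_j}) for an arbitrary
  permutation π of the set {U_j}; (0.7) for a set {U_j} of elements close to the identity of the group, i.e.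
  U_j = exp iA_j with A_j in a small neighborhood of 0 in gᶜ, the average is close to the identity also, and
  (1/i) log M({exp iA_j}) = (1/n) Σ_{j=1}^{n} A_j + (higher order terms); (0.8) if U_j ∈ G, then M({U_j}) ∈ G also. (0.9)"
  and "The considerations and results of this, and previous papers, do not depend on any particular averaging
  operation used; they are valid universally for all averages satisfying the above properties."
T. Bałaban, *Averaging operations for lattice gauge theories*, Comm. Math. Phys. **98**, 17–51 (1985)
[Balaban1985Averaging] (cell paper B7), pp. 21–23 (renders `…1985-cmp98-averaging-p005/p006/p007-x2.png`, quoted in the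
tree headers of `MatrixLog` and `B7BlockAvgLog`): (21) p. 21 "for matrices `X` satisfying `|X − 1| < 1` it is given by
`log X = Σ_{n=1}^∞ ((−1)^{n+1}/n)(X − 1)^n`"; (23) p. 21 the principal logarithm `log U = iA`, `|A| ≤ π` of a unitary
matrix; (26) p. 22 "`|log X| ≤ … ≤ 2|X − 1|`" for `|X − 1| ≤ ½`; (42) p. 23 "`Ū_c = exp[i Σ_{x∈B(c₋)} L^{-d} (1/i) log
U(Γ_{c,x})U(c)^{-1}] U(c)`".  Both papers are manuscripts UNDER ADJUDICATION by the cell; nothing of them is asserted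
here: every declaration below is a definition or a kernel-checked [folklore] fact of matrix analysis about the
printed formula.  VALUE: a kernel inhabitant making the typed (0.4) the PRINTED (0.4) on `U(N)` / `SU(N)`; NOT an
estimate, NOT summit progress.

WHAT THE TREE ALREADY HAS.  `MatrixLog.mlog` = the series (21) in any complete normed `ℂ`-algebra, `exp_mlog`
(`e^{log X} = X`, `|X − 1| < 1`), (26) `norm_mlog_le_two_mul`; `B7BlockAvgLog.mlog_exp` (`log e^C = C` for `‖C‖ < ln 2`)
and the carrier `B7BlockAvgLog.barAvg t wt W = exp(i Σ_{x∈t} wt_x (1/i) log W_x)` of (42)/(78)/(82) with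
`barAvg_eq_exp_sum`; `QuantumLattice.BalabanBlockAverage` (the B7 (42) mean RELATIVE TO A REFERENCE through a
representation `ρ`, `G`-valued by a membership TEST `mean ∈ range ρ`, with `logOnePlus_conj`, `exp_conj_eq_of_mul_eq_one`);
`Literature.Analysis.Matrix.det_exp_eq_exp_trace` (Liouville); `BlockAveraging.LoopAverage` and its inhabitants
`LoopAverage.trivial`, `GroupAverage.toLoopAverage`, `BlockAveragingSU2.su2Mean`; the `GaugeGroup` / `RegularGaugeGroup`
instances of `U(N)`, `SU(N)` (`UnitaryModel` §4: `dist1 U = ‖U − 1‖`, the `L²`-operator norm (19) p. 21 of B7).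

WHAT THIS FILE ADDS (kernel-checked; new sibling module, nothing above is edited).
* §1 [folklore] identities of the series logarithm on SMALL elements of a complete normed `ℂ`-algebra:
  `mlog_eq_neg_of_mul_eq_one` (`XY = 1`, `‖X − 1‖ ≤ 1/3` ⇒ `log Y = −log X`; via `exp_mlog`, uniqueness of inverses and
  `mlog_exp`, the radius `1/3` being where (26) puts `‖log X‖ ≤ 2/3 < ln 2`), `mlog_conj` (`log(vXw) = v(log X)w` for
  `vw = wv = 1`, the tree's `logOnePlus_conj`).
* §2 the printed operation: `eml W := barAvg univ (|I|⁻¹) W = exp[i Σ_i |I|⁻¹ (1/i) log W_i] = exp(|I|⁻¹ Σ_i log W_i)`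
  (`eml_eq_exp`) on a finite family in any such algebra, with (0.7) `eml_comp_equiv` (no smallness), (0.6) for
  `w = v⁻¹`: `eml_conj` (no smallness), (0.5) in the form `eml{W_i⁻¹} · eml{W_i} = 1 = eml{W_i} · eml{W_i⁻¹}` for
  `‖W_i − 1‖ ≤ 1/3` (`eml_inv_mul`, `eml_mul_inv`), and (0.8) WITH VANISHING HIGHER-ORDER TERMS for this operation:
  `(1/i) log eml{exp iA_j} = |I|⁻¹ Σ_j A_j` whenever `‖A_j‖ < ln 2` (`linearisation_exact`).
* §2b [folklore] THE SERIES LOGARITHM (21) IS THE PRINCIPAL LOGARITHM (23) NEAR `1`: for a unitary `u` of any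
  C⋆-algebra with `‖u − 1‖ < 2 ln 2/π ≈ 0.441`, `mlog u = i·arg(u)` (`mlog_coe_unitary_eq_I_smul_arg`; `arg` through the
  continuous functional calculus = Mathlib's `Unitary.argSelfAdjoint`, the `A` of (23) `log U = iA`): `u = e^{iA}`,
  `‖A‖ ≤ (π/2)‖u − 1‖ < ln 2` by (25), then `log e^{iA} = iA`.  This is the identification B7 p. 21 makes between (21) and
  (23), which the tree's `MatrixLog` header (audit remark (ii)) records as NOT kernel-checked; it is what lets §6 state
  the discharge with the PRINCIPAL logarithm, as the objection G-adv2-25 words it.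
* §3 (0.9) on matrices [folklore]: for unitary `W` with `‖W − 1‖ ≤ 1/3`, `(log W)* = −log W` (`star_mlog_eq_neg`), hence
  `eml{W_i} ∈ U(N)` (`eml_mem_unitaryGroup`); for `W ∈ SU(N)` with moreover `N‖W − 1‖ < π`, `tr log W = 0`
  (`trace_mlog_eq_zero`: `e^{tr log W} = det e^{log W} = det W = 1` and `|tr log W| ≤ N‖log W‖ ≤ 2N‖W − 1‖ < 2π`), hence
  `eml{W_i} ∈ SU(N)` (`eml_mem_specialUnitaryGroup`).  KERNEL-CHECKED WITNESS (cell GAPS G-pv11g6-1) that the `SU(N)` radius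
  must shrink like `1/N`, `eml_pair_not_mem_specialUnitaryGroup`: in `SU(N)`, `N ≥ 19`, the central `Z = e^{2πi/N}·1` has
  `‖Z − 1‖ < 1/3`, and the two-member family `{Z, 1}` has `eml = e^{iπ/N}·1`, `det eml = e^{iπ} = −1 ∉ SU(N)`:
  exp-mean-log of `SU(N)`-families of operator-norm radius `1/3` is NOT `SU(N)`-valued for large `N` (series or
  principal logarithm alike — they agree on `Z`, §2b).
* §4–§5 the inhabitants `expMeanLogU : LoopAverage U(N)` (radius `δ = 1/3`) and `expMeanLogSU : LoopAverage SU(N)` (radius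
  `δ_N = min(1/3, π/N)`): `E W = eml{W_i}` on the guard `∀ i, ‖W_i − 1‖ < δ` and `E W = 1` off it (the total extension
  `BlockAveraging` §3 uses anyway: its correction factor is `1` off `Small`), axioms (0.5)–(0.7) PROVED, and `E` Borel
  measurable at every arity (`measurable_expMeanLogU_E`, `measurable_expMeanLogSU_E`: continuous on the open guard,
  constant off it; `ContinuousOn.measurable_piecewise`).
* §6 the discharge, verbatim in the shape the objection G-adv2-25 asked for ("(H-avg): ∃ ℰ₀ : LoopAverage G, ∃ δ₀ > 0,
  ∀ W, (∀ i, dist1 (W i) < δ₀) → ℰ₀.E W = exp[|I|⁻¹ Σ_i log W_i] (principal log on the group)") plus measurability of `E`: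
  `hAvg_unitaryGroup`, `hAvg_specialUnitaryGroup` (value `exp[Σ_i |I|⁻¹ i·arg(W_i)]`, principal logarithm (23), stated
  with the C⋆-algebra structure of `M_N(ℂ)` assembled from Mathlib's `L²`-operator-norm scoped instances exactly as
  `MatrixLog` does inside its proofs) and the series forms `hAvg_unitaryGroup_series`, `hAvg_specialUnitaryGroup_series`
  (value `exp[i Σ_i |I|⁻¹ (1/i) mlog W_i]` as (0.4) prints it) — and the consequences for finite-`ε`
  data block-averaged by `blockAvg expMeanLogSU` on `SU(N)`: `AvgMeasurable` with no residual hypothesis, the reflection-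
  positivity and torus-covariance targets of rung (B)+1 outright, the four targets from existence alone (as
  `BlockAveragingSU2` §6 did for the projected mean on `SU(2)`).
* §7 (v1.1) the two properties print asks of `M` BEFORE (0.5) — "It is a `Gᶜ`-valued function … U_j ∈ Gᶜ … and we assume
  that it is an analytic function" — for the exp-mean-log operation [folklore]: `eml : (I → 𝔸) → 𝔸` is (jointly)
  COMPLEX-ANALYTIC at every family with `‖W_i − 1‖ < 1` for all `i`, in any complete normed `ℂ`-algebra `𝔸`
  (`analyticAt_eml`: coordinate projections are continuous linear, the series logarithm (21) is analytic on `‖X − 1‖ < 1`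
  — `analyticAt_mlog`, from the tree's `analyticAt_logOnePlus` — finite sums and scalar multiples preserve analyticity,
  and `exp` is entire), hence `AnalyticOnNhd` / `ContDiffOn ℂ ⊤` on the open set `smallFamilies I 𝔸 1` of `1`-small
  families (`isOpen_smallFamilies`, `analyticOnNhd_eml`, `contDiffOn_eml`) and complex-differentiable and continuous at
  each of them (`differentiableAt_eml`, `continuousAt_eml`; the guarded inhabitants of §4–§5 are therefore continuous on
  their open guards as matrix-valued maps, `continuousOn_coe_EU`, `continuousOn_coe_ESU`); and `Gᶜ`-VALUED: `eml W` is
  invertible for every family whatsoever (`isUnit_eml`; `Gᶜ = GL` for `G = U(N)`), and has `det = 1` on families of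
  matrices with `det W_i = 1`, `‖W_i − 1‖ ≤ 1/3`, `N‖W_i − 1‖ < π` (`det_eml_eq_one`, via `trace_mlog_eq_zero_of_det_eq_one`
  — the §3 argument uses of `W ∈ SU(N)` only `det W = 1`; `Gᶜ = SL(N, ℂ)` for `G = SU(N)`).  With §2–§3 this makes
  (0.5) (as `eml{W⁻¹}·eml{W} = 1`), (0.6) for `v = u⁻¹`, (0.7), (0.8) (exact), (0.9), analyticity and `Gᶜ`-valuedness
  kernel-checked for the printed operation; two-sided (0.6) and (0.10) remain outside (divergence (c)).

DIVERGENCES FROM PRINT (cell DIVERGENCE row D-pv11g6.1).  (a) `E` is DEFINED with the SERIES logarithm (21)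
(`MatrixLog.mlog`, total, value a possibly non-summable `tsum` off `|X − 1| < 1`); print's (0.4) is read with the
principal logarithm (23); §2b PROVES the two coincide on unitaries with `‖W − 1‖ < 2 ln 2/π`, which contains every guard
used here (`1/3`, `min(1/3, π/N)`), so on its guard `E` IS the printed exp-mean-principal-log (§6); B7's wider agreement
domain `‖W − 1‖ < 1` is not re-proved.  (b) `E` is guarded (value `1` off `∀ i, ‖W_i − 1‖ < δ`); print's `M` is "defined on
sets … with sufficiently small diameters" only, and `BlockAveraging.blockAvg` falls back to the axial value off its own
guard anyway (cell GAPS G-pv11g5-1, G-pv11g5-2).  (c) (0.10) and (0.6) with independent `u`, `v` are not encoded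
(`LoopAverage` asks (0.6) for `v = u⁻¹` only; exp-mean-log is NOT two-sidedly equivariant — print's two-sided (0.6) belongs
to the axiomatic `M` realised by Federbush's (0.10), a different object, G-adv2-25 (β)); `Gᶜ`-valuedness and analyticity,
not encoded in v1, are PROVED for the exp-mean-log operation since v1.1 (§7) — as theorems about `eml` on `1`-small
families of a complete normed `ℂ`-algebra (print's `M` is defined on small `Gᶜ`-families; here `eml` is defined on ALL
families of the ambient algebra `M_N(ℂ) ⊇ GL(N, ℂ) ⊇ U(N)` and analytic near the small ones), still not as fields of
the `LoopAverage` structure, which does not ask for them.  (d) The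
`SU(N)` radius `min(1/3, π/N)` is this file's choice (a `1/N` decay is forced by `tr log ∈ 2πiℤ`, §3); print fixes no
radius ("sufficiently small").  (e) (0.8) is proved here in the EXACT form for THIS operation on `‖A_j‖ < ln 2`; print's
(0.8) (with higher-order terms) is an axiom on the general `M`.

CHANGELOG.  v1 (cell proposal p180398, 2026-08-18).  v1.0.1 (DOCSTRING-ONLY, answering cell GAPS G-ref2-24 (c)): the
docstrings of `T4Continuum.FiniteEpsData.limit_rp_and_cov_of_blockAvgEML` and `…four_targets_of_exists_blockAvgEML`
now tag what those theorems USE ((0.4)/(0.6) p. 253 and tree lemmas) and name B12 Theorem 2 p. 259 as CONTEXT only —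
neither theorem uses Theorem 2; every declaration is byte-identical to v1.  v1.1 (ADDITIVE, answering cell GAPS
G-pv11g5-2 (3) "analyticity … NOT verified for any inhabitant"): new §7 (`analyticAt_mlog`, `smallFamilies`,
`isOpen_smallFamilies`, `analyticAt_eml`, `analyticOnNhd_eml`, `contDiffOn_eml`, `differentiableAt_eml`,
`continuousAt_eml`, `isUnit_eml`, `trace_mlog_eq_zero_of_det_eq_one`, `det_eml_eq_one`, `continuousOn_coe_EU`,
`continuousOn_coe_ESU`); every v1.0.1 declaration is byte-identical; no new import.
-/

noncomputable section

open NormedSpace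

namespace Literature.MathematicalPhysics.QuantumFieldTheory.Balaban1983to89

namespace ExpMeanLog

open MatrixLog B7BlockAvgLog
open Literature.MathematicalPhysics.QuantumLattice (logOnePlus_conj exp_conj_eq_of_mul_eq_one)
open Literature.Analysis.Complex (logOnePlus continuousOn_logOnePlus_comp)
open Literature.Analysis.Matrix (det_exp_eq_exp_trace)

/-! ## 1. Two identities of the series logarithm (21) on small elements -/

section Banach

variable {𝔸 : Type*} [NormedRing 𝔸] [NormedAlgebra ℂ 𝔸] [CompleteSpace 𝔸]

/-- On `‖X − 1‖ ≤ 1/3` the series logarithm has norm `< ln 2` (by (26): `‖log X‖ ≤ 2‖X − 1‖ ≤ 2/3`), i.e. it lies in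
the `log ∘ exp = id` domain of `B7BlockAvgLog.mlog_exp`. [cite: Balaban1985Averaging, (26) p.22] -/
theorem norm_mlog_lt_log_two {X : 𝔸} (hX : ‖X - 1‖ ≤ 1 / 3) : ‖mlog X‖ < Real.log 2 := by
  have h := norm_mlog_le_two_mul (hX.trans (by norm_num))
  have := Real.log_two_gt_d9
  linarith

/-- **`log Y = −log X` for `XY = 1`, `‖X − 1‖ ≤ 1/3`** (series logarithm (21)): `Y = X⁻¹ = e^{−log X}` by
`e^{log X} = X` and uniqueness of inverses, then `log e^{−log X} = −log X` as `‖log X‖ < ln 2`.  (No smallness of `Y`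
is needed; for unitary `X` one has `‖Y − 1‖ = ‖X − 1‖` anyway.) [folklore] -/
theorem mlog_eq_neg_of_mul_eq_one {X Y : 𝔸} (hXY : X * Y = 1) (hX : ‖X - 1‖ ≤ 1 / 3) :
    mlog Y = -mlog X := by
  letI : NormedAlgebra ℚ 𝔸 := NormedAlgebra.restrictScalars ℚ ℂ 𝔸
  have hX1 : ‖X - 1‖ < 1 := lt_of_le_of_lt hX (by norm_num)
  have hexp : exp (mlog X) = X := exp_mlog hX1
  have hinv : exp (-mlog X) * X = 1 := by
    calc exp (-mlog X) * X = exp (-mlog X) * exp (mlog X) := by rw [hexp]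
      _ = exp (-mlog X + mlog X) := (exp_add_of_commute (Commute.refl (mlog X)).neg_left).symm
      _ = 1 := by rw [neg_add_cancel, exp_zero]
  have hY : Y = exp (-mlog X) := by
    calc Y = exp (-mlog X) * X * Y := by rw [hinv, one_mul]
      _ = exp (-mlog X) := by rw [mul_assoc, hXY, mul_one]
  rw [hY]
  exact mlog_exp (by rw [norm_neg]; exact norm_mlog_lt_log_two hX)

/-- **`log(vXw) = v (log X) w` for `vw = wv = 1`** (term by term; the tree's `logOnePlus_conj`, B7 p. 24 "their
logarithms are unitarily equivalent with the same unitary operator"); no smallness needed.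
[cite: Balaban1985Averaging, Sect. B, after (43) p.24] -/
theorem mlog_conj {v w : 𝔸} (hvw : v * w = 1) (hwv : w * v = 1) (X : 𝔸) :
    mlog (v * X * w) = v * mlog X * w := by
  rw [mlog_def, mlog_def, show v * X * w - 1 = v * (X - 1) * w by rw [mul_sub, sub_mul, mul_one, hvw],
    logOnePlus_conj hvw hwv]

/-! ## 2. The printed operation `{W_i} ↦ exp[i Σ_i |I|⁻¹ (1/i) log W_i]` on a finite family -/

variable {ι : Type*} [Fintype ι]

omit [CompleteSpace 𝔸] in
/-- **The operation inside (0.4)**: `eml W = exp[ i Σ_{i∈I} |I|⁻¹ (1/i) log W_i ]` for a finite family `W : I → 𝔸` —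
the tree's carrier `B7BlockAvgLog.barAvg` ((42) p. 23 of B7, base-point factor divided out) over the whole index type
with the UNIFORM weights `|I|⁻¹` that (0.4) assigns to its loop family (`BlockAveraging` §2: the printed weights
`L^{-d}|G(c₋,x)|⁻¹|G(c₊,x′)|⁻¹` are realised as the uniform family over `Idx P`); `log` = the series (21) `MatrixLog.mlog`.
[cite: Balaban1987RG1, (0.4) p.253] -/
def eml (W : ι → 𝔸) : 𝔸 :=
  barAvg Finset.univ (fun _ => ((Fintype.card ι : ℝ))⁻¹) W

omit [CompleteSpace 𝔸] in
/-- Unfolding: `eml W` is literally the printed `exp[i Σ_i |I|⁻¹ (1/i) log W_i]`. [cite: Balaban1987RG1, (0.4) p.253] -/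
theorem eml_def (W : ι → 𝔸) :
    eml W = exp (Complex.I • ∑ i, ((Fintype.card ι : ℝ))⁻¹ • ((Complex.I⁻¹ : ℂ) • mlog (W i))) := rfl

omit [CompleteSpace 𝔸] in
/-- The factors `i`, `1/i` cancelled: `eml W = exp(Σ_i |I|⁻¹ log W_i)` (`barAvg_eq_exp_sum`). [folklore] -/
theorem eml_eq_exp_sum (W : ι → 𝔸) :
    eml W = exp (∑ i, ((Fintype.card ι : ℝ))⁻¹ • mlog (W i)) :=
  barAvg_eq_exp_sum _ _ _

omit [CompleteSpace 𝔸] in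
/-- The factors `i`, `1/i` cancelled and the weight pulled out: `eml W = exp(|I|⁻¹ Σ_i log W_i)`. [folklore] -/
theorem eml_eq_exp (W : ι → 𝔸) :
    eml W = exp (((Fintype.card ι : ℂ))⁻¹ • ∑ i, mlog (W i)) := by
  rw [eml, barAvg_eq_exp_sum, Finset.smul_sum]
  congr 1
  refine Finset.sum_congr rfl fun i _ => ?_
  rw [← Complex.coe_smul, Complex.ofReal_inv, Complex.ofReal_natCast]

omit [CompleteSpace 𝔸] in
/-- **(0.7) for the printed operation**, with no smallness condition: `eml (W ∘ σ) = eml W` for every permutation `σ`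
of the index set (reindexing a finite sum). [cite: Balaban1987RG1, (0.7) p.253] -/
theorem eml_comp_equiv (W : ι → 𝔸) (σ : Equiv.Perm ι) : eml (W ∘ σ) = eml W := by
  simp only [eml_eq_exp, Function.comp_apply]
  rw [Equiv.sum_comp σ (fun i => mlog (W i))]

/-- **(0.6) for the printed operation, conjugations** (`v = w⁻¹`), with no smallness condition:
`eml{v W_i w} = v · eml{W_i} · w` (`log` and `exp` commute with conjugation). [cite: Balaban1987RG1, (0.6) p.253] -/
theorem eml_conj {v w : 𝔸} (hvw : v * w = 1) (hwv : w * v = 1) (W : ι → 𝔸) :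
    eml (fun i => v * W i * w) = v * eml W * w := by
  rw [eml_eq_exp, eml_eq_exp]
  simp_rw [mlog_conj hvw hwv]
  rw [← Finset.sum_mul, ← Finset.mul_sum, ← smul_mul_assoc, ← mul_smul_comm,
    exp_conj_eq_of_mul_eq_one hvw hwv]

/-- The exponent of `eml` of the pointwise inverses is MINUS that of `eml`, on `‖W_i − 1‖ ≤ 1/3`. [folklore] -/
theorem meanLog_eq_neg_of_mul_eq_one {X Y : ι → 𝔸} (h : ∀ i, X i * Y i = 1) (hX : ∀ i, ‖X i - 1‖ ≤ 1 / 3) :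
    ((Fintype.card ι : ℂ))⁻¹ • ∑ i, mlog (Y i) = -(((Fintype.card ι : ℂ))⁻¹ • ∑ i, mlog (X i)) := by
  rw [← smul_neg, ← Finset.sum_neg_distrib]
  congr 1
  exact Finset.sum_congr rfl fun i _ => mlog_eq_neg_of_mul_eq_one (h i) (hX i)

/-- **(0.5) for the printed operation**, left form: if `X_i Y_i = 1` and `‖X_i − 1‖ ≤ 1/3` for all `i`, then
`eml{Y_i} · eml{X_i} = 1`. [cite: Balaban1987RG1, (0.5) p.253] -/
theorem eml_inv_mul {X Y : ι → 𝔸} (h : ∀ i, X i * Y i = 1) (hX : ∀ i, ‖X i - 1‖ ≤ 1 / 3) :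
    eml Y * eml X = 1 := by
  letI : NormedAlgebra ℚ 𝔸 := NormedAlgebra.restrictScalars ℚ ℂ 𝔸
  rw [eml_eq_exp, eml_eq_exp, meanLog_eq_neg_of_mul_eq_one h hX,
    ← exp_add_of_commute (Commute.refl _).neg_left, neg_add_cancel, exp_zero]

/-- **(0.5) for the printed operation**, right form: `eml{X_i} · eml{Y_i} = 1` under the same hypotheses.
[cite: Balaban1987RG1, (0.5) p.253] -/
theorem eml_mul_inv {X Y : ι → 𝔸} (h : ∀ i, X i * Y i = 1) (hX : ∀ i, ‖X i - 1‖ ≤ 1 / 3) :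
    eml X * eml Y = 1 := by
  letI : NormedAlgebra ℚ 𝔸 := NormedAlgebra.restrictScalars ℚ ℂ 𝔸
  rw [eml_eq_exp, eml_eq_exp, meanLog_eq_neg_of_mul_eq_one h hX,
    ← exp_add_of_commute (Commute.refl _).neg_right, add_neg_cancel, exp_zero]

omit [CompleteSpace 𝔸] in
/-- The exponent of `eml` is small when the members are: `‖|I|⁻¹ Σ_i log W_i‖ ≤ max_i … `, in the usable form
"every `‖log W_i‖ < r` ⇒ `‖|I|⁻¹ Σ_i log W_i‖ < r`" (a convex combination; `I` nonempty). [folklore] -/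
theorem norm_meanLog_lt [Nonempty ι] {m : ι → 𝔸} {r : ℝ} (h : ∀ i, ‖m i‖ < r) :
    ‖((Fintype.card ι : ℂ))⁻¹ • ∑ i, m i‖ < r := by
  have hc : (0 : ℝ) < Fintype.card ι := Nat.cast_pos.mpr Fintype.card_pos
  have hsum : ∑ i, ‖m i‖ < ∑ _i : ι, r :=
    Finset.sum_lt_sum_of_nonempty Finset.univ_nonempty fun i _ => h i
  rw [Finset.sum_const, Finset.card_univ, nsmul_eq_mul] at hsum
  rw [norm_smul, norm_inv, Complex.norm_natCast, inv_mul_lt_iff₀ hc]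
  exact (norm_sum_le _ _).trans_lt hsum

/-- **(0.8) for the printed operation, with VANISHING higher-order terms**: if `‖A_j‖ < ln 2` for all `j` (nonempty
family) then `(1/i) log eml{exp iA_j} = |I|⁻¹ Σ_j A_j` exactly (`log e^{iA_j} = iA_j` and `log e^{i·mean} = i·mean` by
`mlog_exp`, the mean of the `iA_j` having norm `< ln 2`).  Print asks (0.8) only up to higher-order terms.
[cite: Balaban1987RG1, (0.8) p.253] -/
theorem linearisation_exact [Nonempty ι] {A : ι → 𝔸} (hA : ∀ j, ‖A j‖ < Real.log 2) :
    (Complex.I⁻¹ : ℂ) • mlog (eml fun j => exp (Complex.I • A j)) = ((Fintype.card ι : ℂ))⁻¹ • ∑ j, A j := by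
  have hIA : ∀ j, ‖Complex.I • A j‖ < Real.log 2 := fun j => by
    rw [norm_smul, Complex.norm_I, one_mul]; exact hA j
  have hlog : ∀ j, mlog (exp (Complex.I • A j)) = Complex.I • A j := fun j => mlog_exp (hIA j)
  rw [eml_eq_exp]
  simp_rw [hlog]
  rw [mlog_exp (norm_meanLog_lt hIA), ← Finset.smul_sum, smul_comm ((Fintype.card ι : ℂ))⁻¹ Complex.I,
    smul_smul, inv_mul_cancel₀ Complex.I_ne_zero, one_smul]

end Banach

/-! ## 2b. The series logarithm (21) IS the principal logarithm (23) on unitaries near `1` -/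

section CStar

open Complex selfAdjoint Unitary

variable {A : Type*} [CStarAlgebra A]

/-- `1/3 < 2 ln 2/π` (`≈ 0.4413`): the radii used below lie inside the domain of the next theorem. [folklore] -/
theorem one_third_lt_two_log_two_div_pi : (1 : ℝ) / 3 < 2 * Real.log 2 / Real.pi := by
  rw [lt_div_iff₀ Real.pi_pos]
  have := Real.log_two_gt_d9
  have := Real.pi_lt_d2
  linarith

/-- **(21) = (23) on unitaries near `1`**: for a unitary `u` of a C⋆-algebra with `‖u − 1‖ < 2 ln 2/π`, the SERIES
logarithm `mlog u` equals the PRINCIPAL logarithm `iA`, `A = arg(u)` of (23) (`Unitary.argSelfAdjoint`: `arg ∈ ]−π, π]`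
applied through the continuous functional calculus — for a unitary matrix `Σ_j e^{iλ_j}P_j ↦ Σ_j λ_j P_j`): `u = e^{iA}`
(`expUnitary_argSelfAdjoint`) with `‖iA‖ = ‖A‖ ≤ (π/2)‖u − 1‖ < ln 2` ((25), `MatrixLog.unitary_norm_arg_le`), so
`mlog u = mlog e^{iA} = iA` (`B7BlockAvgLog.mlog_exp`).  This kernel-checks, on that domain, the identification p. 21
makes ("It is an inverse to the exponential function … We will use this definition … for unitary matrices"), recorded
as UNCHECKED in `MatrixLog`'s audit remark (ii). [cite: Balaban1985Averaging, (21)/(23) p.21] -/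
theorem mlog_coe_unitary_eq_I_smul_arg {u : unitary A} (hu : ‖(u - 1 : A)‖ < 2 * Real.log 2 / Real.pi) :
    mlog (u : A) = I • (argSelfAdjoint u : A) := by
  have hlt2 : 2 * Real.log 2 / Real.pi < 2 := by
    rw [div_lt_iff₀ Real.pi_pos]
    have := Real.log_two_lt_d9
    have := Real.pi_gt_three
    linarith
  have hu2 : ‖(u - 1 : A)‖ < 2 := hu.trans hlt2
  have hexp : (u : A) = exp (I • (argSelfAdjoint u : A)) := by
    have h := congrArg Subtype.val (expUnitary_argSelfAdjoint hu2)
    rw [expUnitary_coe] at h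
    exact h.symm
  have hnorm : ‖I • (argSelfAdjoint u : A)‖ < Real.log 2 := by
    rw [norm_I_smul]
    have h := unitary_norm_arg_le hu2
    have hπ : (0 : ℝ) < Real.pi / 2 := by positivity
    have hπ0 : Real.pi ≠ 0 := Real.pi_ne_zero
    calc ‖(argSelfAdjoint u : A)‖ = ‖argSelfAdjoint u‖ := rfl
      _ ≤ Real.pi / 2 * ‖(u - 1 : A)‖ := h
      _ < Real.pi / 2 * (2 * Real.log 2 / Real.pi) := by gcongr
      _ = Real.log 2 := by field_simp
  rw [hexp]
  exact mlog_exp hnorm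

end CStar

/-! ## 3. (0.9) on matrices: `U(N)`- and `SU(N)`-valuedness of the printed operation on small families -/

section Matrices

open scoped Matrix.Norms.L2Operator

variable {n : Type*} [Fintype n] [DecidableEq n]

/-- `‖X* − 1‖ = ‖X − 1‖` (the `L²`-operator norm is a `C⋆`-norm). [folklore] -/
theorem norm_star_sub_one (X : Matrix n n ℂ) : ‖star X - 1‖ = ‖X - 1‖ := by
  calc ‖star X - 1‖ = ‖star (X - 1)‖ := by rw [star_sub, star_one]
    _ = ‖X - 1‖ := by rw [Matrix.star_eq_conjTranspose, Matrix.l2_opNorm_conjTranspose]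

/-- **`(log W)* = −log W` for a unitary `W` with `‖W − 1‖ ≤ 1/3`** (series logarithm): `log W* = −log W` (§1, as
`WW* = 1`) and `log W* = (log W)*` (`W* = (e^{log W})* = e^{(log W)*}` with `‖(log W)*‖ = ‖log W‖ < ln 2`, then
`mlog_exp`) — the skew-Hermitian `iA` of (23). [cite: Balaban1985Averaging, (23) p.21] -/
theorem star_mlog_eq_neg {X : Matrix n n ℂ} (hX : X ∈ Matrix.unitaryGroup n ℂ) (hs : ‖X - 1‖ ≤ 1 / 3) :
    star (mlog X) = -mlog X := by
  letI : NormedAlgebra ℚ (Matrix n n ℂ) := NormedAlgebra.restrictScalars ℚ ℂ _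
  have hX1 : ‖X - 1‖ < 1 := lt_of_le_of_lt hs (by norm_num)
  have h1 : mlog (star X) = -mlog X := mlog_eq_neg_of_mul_eq_one (Matrix.mem_unitaryGroup_iff.1 hX) hs
  have h2 : star X = exp (star (mlog X)) := by rw [← star_exp, exp_mlog hX1]
  rw [← h1, h2]
  exact (mlog_exp (by
    rw [Matrix.star_eq_conjTranspose, Matrix.l2_opNorm_conjTranspose]; exact norm_mlog_lt_log_two hs)).symm

/-- **(0.9) on `U(N)`**: for unitary `W_i` with `‖W_i − 1‖ ≤ 1/3`, `eml{W_i} ∈ U(N)` — the exponent `|I|⁻¹ Σ_i log W_i`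
is skew-Hermitian, so its exponential is unitary. [cite: Balaban1987RG1, (0.9) p.253] -/
theorem eml_mem_unitaryGroup {ι : Type*} [Fintype ι] {W : ι → Matrix n n ℂ}
    (hW : ∀ i, W i ∈ Matrix.unitaryGroup n ℂ) (hs : ∀ i, ‖W i - 1‖ ≤ 1 / 3) :
    eml W ∈ Matrix.unitaryGroup n ℂ := by
  letI : NormedAlgebra ℚ (Matrix n n ℂ) := NormedAlgebra.restrictScalars ℚ ℂ _
  set M : Matrix n n ℂ := ((Fintype.card ι : ℂ))⁻¹ • ∑ i, mlog (W i) with hM_def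
  have hM : star M = -M := by
    simp only [hM_def, star_smul, star_sum, star_inv₀, star_natCast, star_mlog_eq_neg (hW _) (hs _),
      Finset.sum_neg_distrib, smul_neg]
  rw [eml_eq_exp, ← hM_def, Matrix.mem_unitaryGroup_iff, star_exp, hM,
    ← exp_add_of_commute (Commute.refl M).neg_right, add_neg_cancel, exp_zero]

/-- **`tr log W = 0` for `W ∈ SU(N)` with `‖W − 1‖ ≤ 1/3` and `N‖W − 1‖ < π`** (series logarithm): `e^{tr log W} =
det e^{log W} = det W = 1` (Liouville, `det_exp_eq_exp_trace`), so `tr log W ∈ 2πiℤ`, and `|tr log W| ≤ N‖log W‖ ≤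
2N‖W − 1‖ < 2π` ((20), (26)).  The hypothesis `N‖W − 1‖ < π` cannot be dropped: `W = e^{2πi/N}·1 ∈ SU(N)`, `N ≥ 19`,
has `‖W − 1‖ = 2 sin(π/N) < 1/3` and `tr log W = 2πi`. [folklore] -/
theorem trace_mlog_eq_zero {X : Matrix n n ℂ} (hX : X ∈ Matrix.specialUnitaryGroup n ℂ)
    (hs : ‖X - 1‖ ≤ 1 / 3) (hπ : Fintype.card n * ‖X - 1‖ < Real.pi) : (mlog X).trace = 0 := by
  have hX1 : ‖X - 1‖ < 1 := lt_of_le_of_lt hs (by norm_num)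
  have hexp : Complex.exp (mlog X).trace = 1 := by
    rw [Complex.exp_eq_exp_ℂ, ← det_exp_eq_exp_trace, exp_mlog hX1]
    exact (Matrix.mem_specialUnitaryGroup_iff.1 hX).2
  obtain ⟨k, hk⟩ := Complex.exp_eq_one_iff.1 hexp
  have hbd : ‖(mlog X).trace‖ < 2 * Real.pi := by
    -- `|Tr M| ≤ N‖M‖` (B7 (20) for the normalized trace, `MatrixNorms.norm_ntr_le_opNorm`; the same inequality is the
    -- tree's `QuantumLattice.norm_trace_le_card_mul_norm`, whose module is not imported here to keep the closure small)
    have h1 : ‖(mlog X).trace‖ ≤ Fintype.card n * ‖mlog X‖ := by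
      rcases isEmpty_or_nonempty n with hn | hn
      · simp [Matrix.trace]
      have hc : (0 : ℝ) < Fintype.card n := Nat.cast_pos.mpr Fintype.card_pos
      have h : ‖(mlog X).trace / (Fintype.card n : ℂ)‖ ≤ ‖mlog X‖ := MatrixNorms.norm_ntr_le_opNorm (mlog X)
      rw [norm_div, Complex.norm_natCast, div_le_iff₀ hc] at h
      linarith [mul_comm (Fintype.card n : ℝ) ‖mlog X‖]
    have h2 : ‖mlog X‖ ≤ 2 * ‖X - 1‖ := norm_mlog_le_two_mul (hs.trans (by norm_num))
    have hc : (0 : ℝ) ≤ Fintype.card n := Nat.cast_nonneg _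
    nlinarith [mul_le_mul_of_nonneg_left h2 hc]
  have hk0 : k = 0 := by
    have h2π : ‖(k : ℂ) * (2 * Real.pi * Complex.I)‖ < 2 * Real.pi := by rw [← hk]; exact hbd
    have hn : ‖(2 * Real.pi * Complex.I : ℂ)‖ = 2 * Real.pi := by
      simp [abs_of_pos Real.pi_pos]
    rw [norm_mul, hn, Complex.norm_intCast] at h2π
    have hk1 : |(k : ℝ)| < 1 := (mul_lt_iff_lt_one_left (by positivity)).1 h2π
    have : |k| < 1 := by exact_mod_cast hk1
    exact Int.abs_lt_one_iff.1 this
  rw [hk, hk0]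
  simp

/-- **(0.9) on `SU(N)`**: for `W_i ∈ SU(N)` with `‖W_i − 1‖ ≤ 1/3` and `N‖W_i − 1‖ < π`, `eml{W_i} ∈ SU(N)`
(`det eml = e^{|I|⁻¹ Σ_i tr log W_i} = e^0 = 1`). [cite: Balaban1987RG1, (0.9) p.253] -/
theorem eml_mem_specialUnitaryGroup {ι : Type*} [Fintype ι] {W : ι → Matrix n n ℂ}
    (hW : ∀ i, W i ∈ Matrix.specialUnitaryGroup n ℂ) (hs : ∀ i, ‖W i - 1‖ ≤ 1 / 3)
    (hπ : ∀ i, Fintype.card n * ‖W i - 1‖ < Real.pi) :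
    eml W ∈ Matrix.specialUnitaryGroup n ℂ := by
  rw [Matrix.mem_specialUnitaryGroup_iff]
  refine ⟨eml_mem_unitaryGroup (fun i => (Matrix.mem_specialUnitaryGroup_iff.1 (hW i)).1) hs, ?_⟩
  rw [eml_eq_exp, det_exp_eq_exp_trace, Matrix.trace_smul, Matrix.trace_sum,
    Finset.sum_eq_zero fun i _ => trace_mlog_eq_zero (hW i) (hs i) (hπ i), smul_zero, exp_zero]

/-- Conjugation by a unitary does not move `‖· − 1‖`: `‖uXw − 1‖ = ‖X − 1‖` whenever `uw = 1` and `u`, `w` are unitary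
(`uXw − 1 = u(X − 1)w` and the `L²`-operator norm is unitarily invariant). [folklore] -/
theorem norm_conj_sub_one_eq {u w X : Matrix n n ℂ} (hu : u ∈ Matrix.unitaryGroup n ℂ)
    (hw : w ∈ Matrix.unitaryGroup n ℂ) (huw : u * w = 1) : ‖u * X * w - 1‖ = ‖X - 1‖ := by
  rw [show u * X * w - 1 = u * (X - 1) * w by rw [mul_sub, sub_mul, mul_one, huw],
    CStarRing.norm_mul_mem_unitary _ hw, CStarRing.norm_mem_unitary_mul _ hu]

/-! ### The `1/N` decay of the `SU(N)` radius is forced (located remark, cell GAPS G-pv11g6-1) -/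

/-- `exp` of a scalar matrix: `exp(c·1) = e^c·1`. [folklore] -/
theorem exp_smul_one_eq {N : ℕ} (c : ℂ) :
    exp (c • (1 : Matrix (Fin N) (Fin N) ℂ)) = Complex.exp c • (1 : Matrix (Fin N) (Fin N) ℂ) := by
  rw [← Algebra.algebraMap_eq_smul_one, ← Algebra.algebraMap_eq_smul_one, Complex.exp_eq_exp_ℂ]
  exact (algebraMap_exp_comm (𝔸 := Matrix (Fin N) (Fin N) ℂ) c).symm

/-- **The `SU(N)` radius cannot be `N`-independent**: for `N ≥ 19` the central element `Z = e^{2πi/N}·1 ∈ SU(N)` has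
`‖Z − 1‖ < 1/3`, yet the exp-mean-log of the two-member `SU(N)`-family `{Z, 1}` is `e^{iπ/N}·1`, of determinant
`e^{iπ} = −1` — not in `SU(N)` (here `log` = the series (21), which agrees with the principal logarithm on `Z`, §2b).
[folklore] -/
theorem eml_pair_not_mem_specialUnitaryGroup {N : ℕ} (hN : 19 ≤ N) :
    let Z : Matrix (Fin N) (Fin N) ℂ := Complex.exp (((2 * Real.pi / N : ℝ) : ℂ) * Complex.I) • 1
    Z ∈ Matrix.specialUnitaryGroup (Fin N) ℂ ∧ ‖Z - 1‖ < 1 / 3 ∧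
      eml ![Z, 1] ∉ Matrix.specialUnitaryGroup (Fin N) ℂ := by
  intro Z
  haveI : NeZero N := ⟨by omega⟩
  letI : NormedAlgebra ℚ (Matrix (Fin N) (Fin N) ℂ) := NormedAlgebra.restrictScalars ℚ ℂ _
  have hN0 : (N : ℂ) ≠ 0 := Nat.cast_ne_zero.mpr (NeZero.ne N)
  have hNr : (0 : ℝ) < N := Nat.cast_pos.mpr (Nat.pos_of_ne_zero (NeZero.ne N))
  set x : ℝ := 2 * Real.pi / N with hx_def
  set θ : ℂ := (x : ℂ) * Complex.I with hθ_def
  have hZ_def : Z = Complex.exp θ • (1 : Matrix (Fin N) (Fin N) ℂ) := rfl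
  have hx_pos : 0 < x := div_pos (by positivity) hNr
  have hx_lt : x < 1 / 3 := by
    rw [hx_def, div_lt_iff₀ hNr]
    have h19 : (19 : ℝ) ≤ N := by exact_mod_cast hN
    have := Real.pi_lt_d2
    nlinarith
  -- `N θ = 2πi`, `N (θ/2) = πi`
  have hNθ : (N : ℂ) * θ = 2 * Real.pi * Complex.I := by
    rw [hθ_def, hx_def, Complex.ofReal_div, Complex.ofReal_mul, Complex.ofReal_natCast, Complex.ofReal_ofNat]
    field_simp
  have hNθ2 : (N : ℂ) * (θ / 2) = Real.pi * Complex.I := by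
    rw [mul_div_assoc', hNθ]; ring
  -- membership of `Z`
  have hZexp : Z = exp (θ • (1 : Matrix (Fin N) (Fin N) ℂ)) := by rw [hZ_def, exp_smul_one_eq]
  have hZU : Z ∈ Matrix.unitaryGroup (Fin N) ℂ := by
    rw [Matrix.mem_unitaryGroup_iff, hZ_def, star_smul, star_one, smul_mul_assoc, one_mul, smul_smul,
      Complex.star_def, Complex.mul_conj, Complex.normSq_eq_norm_sq, Complex.norm_exp_ofReal_mul_I]
    simp
  have hZSU : Z ∈ Matrix.specialUnitaryGroup (Fin N) ℂ := by
    rw [Matrix.mem_specialUnitaryGroup_iff]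
    refine ⟨hZU, ?_⟩
    rw [hZ_def, Matrix.det_smul, Matrix.det_one, mul_one, Fintype.card_fin, ← Complex.exp_nat_mul, hNθ,
      Complex.exp_two_pi_mul_I]
  -- the norm of `Z − 1`
  have hθnorm : ‖θ‖ = x := by
    rw [hθ_def, norm_mul, Complex.norm_I, mul_one, Complex.norm_real, Real.norm_of_nonneg hx_pos.le]
  have hZ1 : ‖Z - 1‖ < 1 / 3 := by
    have h1 : Z - 1 = (Complex.exp θ - 1) • (1 : Matrix (Fin N) (Fin N) ℂ) := by rw [sub_smul, one_smul, hZ_def]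
    rw [h1, norm_smul, CStarRing.norm_one, mul_one]
    have h2 : ‖Complex.exp θ - 1‖ ≤ ‖x‖ := by
      rw [hθ_def, mul_comm]; exact Real.norm_exp_I_mul_ofReal_sub_one_le
    rw [Real.norm_of_nonneg hx_pos.le] at h2
    exact h2.trans_lt hx_lt
  refine ⟨hZSU, hZ1, ?_⟩
  -- the exp-mean-log of `{Z, 1}`
  have hlogZ : mlog Z = θ • (1 : Matrix (Fin N) (Fin N) ℂ) := by
    rw [hZexp]
    refine mlog_exp ?_
    rw [norm_smul, CStarRing.norm_one, mul_one, hθnorm]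
    have := Real.log_two_gt_d9
    linarith
  have heml : eml ![Z, 1] = Complex.exp (θ / 2) • (1 : Matrix (Fin N) (Fin N) ℂ) := by
    rw [eml_eq_exp, Fintype.card_fin, Fin.sum_univ_two, Matrix.cons_val_zero, Matrix.cons_val_one,
      Matrix.cons_val_fin_one, mlog_one, add_zero, hlogZ, smul_smul, ← exp_smul_one_eq]
    congr 2
    push_cast
    ring
  intro hmem
  have hdet := (Matrix.mem_specialUnitaryGroup_iff.1 hmem).2
  rw [heml, Matrix.det_smul, Matrix.det_one, mul_one, Fintype.card_fin, ← Complex.exp_nat_mul, hNθ2,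
    Complex.exp_pi_mul_I] at hdet
  norm_num at hdet

/-! ## 4. The inhabitant of `LoopAverage U(N)` -/

/-- The guarded printed operation on `U(N)`-families: `eml{W_i}` if every `‖W_i − 1‖ < 1/3`, else `1` — total and
`U(N)`-valued by §3 (0.9). [cite: Balaban1987RG1, (0.4)/(0.9) p.253] -/
def EU {ι : Type*} [Fintype ι] (W : ι → Matrix.unitaryGroup n ℂ) : Matrix.unitaryGroup n ℂ :=
  ⟨if ∀ i, ‖(W i : Matrix n n ℂ) - 1‖ < 1 / 3 then eml (fun i => (W i : Matrix n n ℂ)) else 1, by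
    split_ifs with h
    · exact eml_mem_unitaryGroup (fun i => (W i).2) fun i => (h i).le
    · exact Submonoid.one_mem _⟩

section UN

variable {ι : Type*} [Fintype ι]

/-- On the guard, `EU W` IS the printed operation. [cite: Balaban1987RG1, (0.4) p.253] -/
theorem coe_EU_of_small {W : ι → Matrix.unitaryGroup n ℂ} (h : ∀ i, ‖(W i : Matrix n n ℂ) - 1‖ < 1 / 3) :
    ((EU W : Matrix.unitaryGroup n ℂ) : Matrix n n ℂ) = eml fun i => (W i : Matrix n n ℂ) :=
  if_pos h

/-- Off the guard, `EU W = 1`. [folklore] -/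
theorem EU_of_not_small {W : ι → Matrix.unitaryGroup n ℂ} (h : ¬ ∀ i, ‖(W i : Matrix n n ℂ) - 1‖ < 1 / 3) :
    EU W = 1 :=
  Subtype.ext (if_neg h)

/-- **(0.7) for `EU`** (all families). [cite: Balaban1987RG1, (0.7) p.253] -/
theorem EU_perm (W : ι → Matrix.unitaryGroup n ℂ) (σ : Equiv.Perm ι) : EU (W ∘ σ) = EU W := by
  by_cases h : ∀ i, ‖(W i : Matrix n n ℂ) - 1‖ < 1 / 3
  · have h' : ∀ i, ‖((W ∘ σ) i : Matrix n n ℂ) - 1‖ < 1 / 3 := fun i => h (σ i)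
    apply Subtype.ext
    rw [coe_EU_of_small h', coe_EU_of_small h]
    exact eml_comp_equiv (fun i => (W i : Matrix n n ℂ)) σ
  · have h' : ¬ ∀ i, ‖((W ∘ σ) i : Matrix n n ℂ) - 1‖ < 1 / 3 := fun h' => h fun i => by
      have := h' (σ.symm i)
      rwa [Function.comp_apply, Equiv.apply_symm_apply] at this
    rw [EU_of_not_small h', EU_of_not_small h]

/-- **(0.5) for `EU`** on the guard. [cite: Balaban1987RG1, (0.5) p.253] -/
theorem EU_inv {W : ι → Matrix.unitaryGroup n ℂ} (h : ∀ i, ‖(W i : Matrix n n ℂ) - 1‖ < 1 / 3) :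
    EU (fun i => (W i)⁻¹) = (EU W)⁻¹ := by
  have h' : ∀ i, ‖(((W i)⁻¹ : Matrix.unitaryGroup n ℂ) : Matrix n n ℂ) - 1‖ < 1 / 3 := fun i => by
    show ‖star (W i : Matrix n n ℂ) - 1‖ < 1 / 3
    rw [norm_star_sub_one]; exact h i
  apply eq_inv_of_mul_eq_one_left
  apply Subtype.ext
  show ((EU fun i => (W i)⁻¹) : Matrix n n ℂ) * (EU W : Matrix n n ℂ) = 1
  rw [coe_EU_of_small h', coe_EU_of_small h]
  exact eml_inv_mul (fun i => Unitary.coe_mul_star_self (W i)) fun i => (h i).le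

/-- **(0.6) for `EU`, conjugations**, on the guard. [cite: Balaban1987RG1, (0.6) p.253] -/
theorem EU_conj {W : ι → Matrix.unitaryGroup n ℂ} (h : ∀ i, ‖(W i : Matrix n n ℂ) - 1‖ < 1 / 3)
    (u : Matrix.unitaryGroup n ℂ) : EU (fun i => u * W i * u⁻¹) = u * EU W * u⁻¹ := by
  have hvw : (u : Matrix n n ℂ) * ((u⁻¹ : Matrix.unitaryGroup n ℂ) : Matrix n n ℂ) = 1 :=
    Unitary.coe_mul_star_self u
  have hwv : ((u⁻¹ : Matrix.unitaryGroup n ℂ) : Matrix n n ℂ) * (u : Matrix n n ℂ) = 1 :=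
    Unitary.coe_star_mul_self u
  have h' : ∀ i, ‖((u * W i * u⁻¹ : Matrix.unitaryGroup n ℂ) : Matrix n n ℂ) - 1‖ < 1 / 3 := fun i => by
    show ‖(u : Matrix n n ℂ) * (W i : Matrix n n ℂ) * ((u⁻¹ : Matrix.unitaryGroup n ℂ) : Matrix n n ℂ) - 1‖ < 1 / 3
    rw [norm_conj_sub_one_eq u.2 (u⁻¹).2 hvw]; exact h i
  apply Subtype.ext
  show ((EU fun i => u * W i * u⁻¹) : Matrix n n ℂ) =
    (u : Matrix n n ℂ) * (EU W : Matrix n n ℂ) * ((u⁻¹ : Matrix.unitaryGroup n ℂ) : Matrix n n ℂ)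
  rw [coe_EU_of_small h', coe_EU_of_small h]
  exact eml_conj hvw hwv fun i => (W i : Matrix n n ℂ)

/-- **MEASURABILITY of `EU`** `: (I → U(N)) → U(N)` for every finite index type (Borel structures, product σ-algebra):
continuous on the OPEN guard (the series `log` is continuous on `|X − 1| < 1`, `exp` is continuous), constant off it.
[folklore] -/
theorem measurable_EU : Measurable (EU : (ι → Matrix.unitaryGroup n ℂ) → Matrix.unitaryGroup n ℂ) := by
  classical
  letI : NormedAlgebra ℚ (Matrix n n ℂ) := NormedAlgebra.restrictScalars ℚ ℂ _
  set s : Set (ι → Matrix.unitaryGroup n ℂ) := {W | ∀ i, ‖(W i : Matrix n n ℂ) - 1‖ < 1 / 3} with hs_def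
  have hco : ∀ i, Continuous fun W : ι → Matrix.unitaryGroup n ℂ => (W i : Matrix n n ℂ) - 1 := fun i =>
    (continuous_subtype_val.comp (continuous_apply i)).sub continuous_const
  have hs_open : IsOpen s := by
    rw [hs_def, Set.setOf_forall]
    exact isOpen_iInter_of_finite fun i => isOpen_lt (hco i).norm continuous_const
  have hcont : ContinuousOn (EU : (ι → Matrix.unitaryGroup n ℂ) → Matrix.unitaryGroup n ℂ) s := by
    refine Topology.IsInducing.subtypeVal.continuousOn_iff.2 ?_
    have hlog : ∀ i, ContinuousOn (fun W : ι → Matrix.unitaryGroup n ℂ => mlog (W i : Matrix n n ℂ)) s :=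
      fun i => continuousOn_logOnePlus_comp (hco i).continuousOn fun W hW => (hW i).trans (by norm_num)
    have hexp : ContinuousOn (fun W : ι → Matrix.unitaryGroup n ℂ =>
        exp (((Fintype.card ι : ℂ))⁻¹ • ∑ i, mlog (W i : Matrix n n ℂ))) s :=
      exp_continuous.comp_continuousOn ((continuousOn_finsetSum Finset.univ fun i _ => hlog i).fun_const_smul _)
    refine hexp.congr fun W hW => ?_
    show ((EU W : Matrix.unitaryGroup n ℂ) : Matrix n n ℂ) = _
    rw [coe_EU_of_small hW, eml_eq_exp]
  have hcont' : ContinuousOn (EU : (ι → Matrix.unitaryGroup n ℂ) → Matrix.unitaryGroup n ℂ) sᶜ :=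
    continuousOn_const.congr fun W hW => EU_of_not_small hW
  have hpw := ContinuousOn.measurable_piecewise hcont hcont' hs_open.measurableSet
  rwa [Set.piecewise_same] at hpw

end UN

section UNInstance

variable [Nonempty n]

/-- **The printed small-loop average on `U(N)`** as an inhabitant of `LoopAverage U(N)` (`BlockAveraging` §0): radius
`δ = 1/3`, `E W = exp[i Σ_i |I|⁻¹ (1/i) log W_i]` on `∀ i, ‖W_i − 1‖ < 1/3` (value `1` off it), the axioms (0.5), (0.6)
(conjugations), (0.7) PROVED (§2–§4).  In the model `dist1 W = ‖W − 1‖` (`UnitaryModel` §4, `rfl`).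
[cite: Balaban1987RG1, (0.4)–(0.7) p.253] -/
def expMeanLogU : LoopAverage (Matrix.unitaryGroup n ℂ) where
  δ := 1 / 3
  δ_pos := by norm_num
  E := fun W => EU W
  inv := fun _ hW => EU_inv hW
  conj := fun _ hW u => EU_conj hW u
  perm := fun W _ σ => EU_perm W σ

/-- The radius of `expMeanLogU` is `1/3`. [folklore] -/
theorem expMeanLogU_δ : (expMeanLogU (n := n)).δ = 1 / 3 := rfl

/-- On the guard `∀ i, dist1 W_i < 1/3`, `expMeanLogU.E W` is the printed `exp[i Σ_i |I|⁻¹ (1/i) log W_i]`.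
[cite: Balaban1987RG1, (0.4) p.253] -/
theorem coe_expMeanLogU_E {m : ℕ} (W : Fin (m + 1) → Matrix.unitaryGroup n ℂ) (hW : ∀ i, dist1 (W i) < 1 / 3) :
    (((expMeanLogU (n := n)).E W : Matrix.unitaryGroup n ℂ) : Matrix n n ℂ) =
      exp (Complex.I • ∑ i, ((m + 1 : ℕ) : ℝ)⁻¹ • ((Complex.I⁻¹ : ℂ) • mlog (W i : Matrix n n ℂ))) := by
  show ((EU W : Matrix.unitaryGroup n ℂ) : Matrix n n ℂ) = _
  rw [coe_EU_of_small hW, eml_def, Fintype.card_fin]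

/-- **PRINCIPAL-LOGARITHM FORM** of the same value: on the guard, `expMeanLogU.E W = exp[Σ_i |I|⁻¹ log W_i]` with `log`
the principal logarithm (23), `log W_i = iA_i`, `A_i = arg(W_i)` (`Unitary.argSelfAdjoint` in the C⋆-algebra `M_N(ℂ)` of
the `L²`-operator norm, assembled from Mathlib's scoped instances as in `MatrixLog`) — by §2b, since `1/3 < 2 ln 2/π`.
[cite: Balaban1987RG1, (0.4) p.253] -/
theorem coe_expMeanLogU_E_eq_exp_mean_arg {m : ℕ} (W : Fin (m + 1) → Matrix.unitaryGroup n ℂ)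
    (hW : ∀ i, dist1 (W i) < 1 / 3) :
    letI : CStarAlgebra (Matrix n n ℂ) := {}
    (((expMeanLogU (n := n)).E W : Matrix.unitaryGroup n ℂ) : Matrix n n ℂ) =
      exp (∑ i, ((m + 1 : ℕ) : ℝ)⁻¹ • (Complex.I • (Unitary.argSelfAdjoint (W i) : Matrix n n ℂ))) := by
  letI : CStarAlgebra (Matrix n n ℂ) := {}
  show ((EU W : Matrix.unitaryGroup n ℂ) : Matrix n n ℂ) = _
  rw [coe_EU_of_small hW, eml_eq_exp_sum, Fintype.card_fin]
  congr 1
  refine Finset.sum_congr rfl fun i _ => ?_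
  rw [mlog_coe_unitary_eq_I_smul_arg ((hW i).trans one_third_lt_two_log_two_div_pi)]

/-- `expMeanLogU.E` is Borel measurable at every arity — the hypothesis `hE` of
`T4Continuum.FiniteEpsData.avgMeasurable_of_blockAvg` / `LoopAverage.MeasurableE` of `T4Apex`. [folklore] -/
theorem measurable_expMeanLogU_E (m : ℕ) :
    Measurable fun W : Fin (m + 1) → Matrix.unitaryGroup n ℂ => (expMeanLogU (n := n)).E W :=
  measurable_EU

end UNInstance

/-! ## 5. The inhabitant of `LoopAverage SU(N)` -/

section SUN

variable [Nonempty n]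

/-- The `SU(N)` radius `δ_N = min(1/3, π/N)` (`N = Fintype.card n`): inside it (26) gives `‖log W‖ < ln 2` AND
`N‖log W‖ < 2π`, the latter forcing `tr log W = 0` (§3). [folklore] -/
def deltaSU (n : Type*) [Fintype n] : ℝ := min (1 / 3) (Real.pi / Fintype.card n)

omit [DecidableEq n] in
/-- `δ_N > 0`. [folklore] -/
theorem deltaSU_pos : 0 < deltaSU n :=
  lt_min (by norm_num) (div_pos Real.pi_pos (Nat.cast_pos.mpr Fintype.card_pos))

omit [DecidableEq n] [Nonempty n] in
/-- `t < δ_N ⇒ t < 1/3`. [folklore] -/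
theorem lt_third_of_lt_deltaSU {t : ℝ} (h : t < deltaSU n) : t < 1 / 3 := h.trans_le (min_le_left _ _)

omit [DecidableEq n] in
/-- `t < δ_N ⇒ N·t < π`. [folklore] -/
theorem mul_lt_pi_of_lt_deltaSU {t : ℝ} (h : t < deltaSU n) : Fintype.card n * t < Real.pi := by
  have hc : (0 : ℝ) < Fintype.card n := Nat.cast_pos.mpr Fintype.card_pos
  have h' : t < Real.pi / Fintype.card n := h.trans_le (min_le_right _ _)
  rw [lt_div_iff₀ hc] at h'
  linarith [mul_comm (Fintype.card n : ℝ) t]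

/-- The guarded printed operation on `SU(N)`-families: `eml{W_i}` if every `‖W_i − 1‖ < δ_N`, else `1` — total and
`SU(N)`-valued by §3 (0.9). [cite: Balaban1987RG1, (0.4)/(0.9) p.253] -/
def ESU {ι : Type*} [Fintype ι] (W : ι → Matrix.specialUnitaryGroup n ℂ) : Matrix.specialUnitaryGroup n ℂ :=
  ⟨if ∀ i, ‖(W i : Matrix n n ℂ) - 1‖ < deltaSU n then eml (fun i => (W i : Matrix n n ℂ)) else 1, by
    split_ifs with h
    · exact eml_mem_specialUnitaryGroup (fun i => (W i).2) (fun i => (lt_third_of_lt_deltaSU (h i)).le)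
        fun i => mul_lt_pi_of_lt_deltaSU (h i)
    · exact Submonoid.one_mem _⟩

variable {ι : Type*} [Fintype ι]

/-- On the guard, `ESU W` IS the printed operation. [cite: Balaban1987RG1, (0.4) p.253] -/
theorem coe_ESU_of_small {W : ι → Matrix.specialUnitaryGroup n ℂ}
    (h : ∀ i, ‖(W i : Matrix n n ℂ) - 1‖ < deltaSU n) :
    ((ESU W : Matrix.specialUnitaryGroup n ℂ) : Matrix n n ℂ) = eml fun i => (W i : Matrix n n ℂ) :=
  if_pos h

/-- Off the guard, `ESU W = 1`. [folklore] -/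
theorem ESU_of_not_small {W : ι → Matrix.specialUnitaryGroup n ℂ}
    (h : ¬ ∀ i, ‖(W i : Matrix n n ℂ) - 1‖ < deltaSU n) : ESU W = 1 :=
  Subtype.ext (if_neg h)

/-- **(0.7) for `ESU`** (all families). [cite: Balaban1987RG1, (0.7) p.253] -/
theorem ESU_perm (W : ι → Matrix.specialUnitaryGroup n ℂ) (σ : Equiv.Perm ι) : ESU (W ∘ σ) = ESU W := by
  by_cases h : ∀ i, ‖(W i : Matrix n n ℂ) - 1‖ < deltaSU n
  · have h' : ∀ i, ‖((W ∘ σ) i : Matrix n n ℂ) - 1‖ < deltaSU n := fun i => h (σ i)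
    apply Subtype.ext
    rw [coe_ESU_of_small h', coe_ESU_of_small h]
    exact eml_comp_equiv (fun i => (W i : Matrix n n ℂ)) σ
  · have h' : ¬ ∀ i, ‖((W ∘ σ) i : Matrix n n ℂ) - 1‖ < deltaSU n := fun h' => h fun i => by
      have := h' (σ.symm i)
      rwa [Function.comp_apply, Equiv.apply_symm_apply] at this
    rw [ESU_of_not_small h', ESU_of_not_small h]

/-- **(0.5) for `ESU`** on the guard. [cite: Balaban1987RG1, (0.5) p.253] -/
theorem ESU_inv {W : ι → Matrix.specialUnitaryGroup n ℂ} (h : ∀ i, ‖(W i : Matrix n n ℂ) - 1‖ < deltaSU n) :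
    ESU (fun i => (W i)⁻¹) = (ESU W)⁻¹ := by
  have h' : ∀ i, ‖(((W i)⁻¹ : Matrix.specialUnitaryGroup n ℂ) : Matrix n n ℂ) - 1‖ < deltaSU n := fun i => by
    show ‖star (W i : Matrix n n ℂ) - 1‖ < deltaSU n
    rw [norm_star_sub_one]; exact h i
  apply eq_inv_of_mul_eq_one_left
  apply Subtype.ext
  show ((ESU fun i => (W i)⁻¹) : Matrix n n ℂ) * (ESU W : Matrix n n ℂ) = 1
  rw [coe_ESU_of_small h', coe_ESU_of_small h]
  exact eml_inv_mul (fun i => Unitary.mul_star_self_of_mem (Matrix.mem_specialUnitaryGroup_iff.1 (W i).2).1)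
    fun i => (lt_third_of_lt_deltaSU (h i)).le

/-- **(0.6) for `ESU`, conjugations**, on the guard. [cite: Balaban1987RG1, (0.6) p.253] -/
theorem ESU_conj {W : ι → Matrix.specialUnitaryGroup n ℂ} (h : ∀ i, ‖(W i : Matrix n n ℂ) - 1‖ < deltaSU n)
    (u : Matrix.specialUnitaryGroup n ℂ) : ESU (fun i => u * W i * u⁻¹) = u * ESU W * u⁻¹ := by
  have hu : (u : Matrix n n ℂ) ∈ Matrix.unitaryGroup n ℂ := (Matrix.mem_specialUnitaryGroup_iff.1 u.2).1
  have hu' : ((u⁻¹ : Matrix.specialUnitaryGroup n ℂ) : Matrix n n ℂ) ∈ Matrix.unitaryGroup n ℂ :=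
    (Matrix.mem_specialUnitaryGroup_iff.1 (u⁻¹).2).1
  have hvw : (u : Matrix n n ℂ) * ((u⁻¹ : Matrix.specialUnitaryGroup n ℂ) : Matrix n n ℂ) = 1 :=
    Unitary.mul_star_self_of_mem hu
  have hwv : ((u⁻¹ : Matrix.specialUnitaryGroup n ℂ) : Matrix n n ℂ) * (u : Matrix n n ℂ) = 1 :=
    Unitary.star_mul_self_of_mem hu
  have h' : ∀ i, ‖((u * W i * u⁻¹ : Matrix.specialUnitaryGroup n ℂ) : Matrix n n ℂ) - 1‖ < deltaSU n := fun i => by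
    show ‖(u : Matrix n n ℂ) * (W i : Matrix n n ℂ) * ((u⁻¹ : Matrix.specialUnitaryGroup n ℂ) : Matrix n n ℂ) - 1‖
      < deltaSU n
    rw [norm_conj_sub_one_eq hu hu' hvw]; exact h i
  apply Subtype.ext
  show ((ESU fun i => u * W i * u⁻¹) : Matrix n n ℂ) =
    (u : Matrix n n ℂ) * (ESU W : Matrix n n ℂ) * ((u⁻¹ : Matrix.specialUnitaryGroup n ℂ) : Matrix n n ℂ)
  rw [coe_ESU_of_small h', coe_ESU_of_small h]
  exact eml_conj hvw hwv fun i => (W i : Matrix n n ℂ)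

/-- **MEASURABILITY of `ESU`** `: (I → SU(N)) → SU(N)` for every finite index type. [folklore] -/
theorem measurable_ESU :
    Measurable (ESU : (ι → Matrix.specialUnitaryGroup n ℂ) → Matrix.specialUnitaryGroup n ℂ) := by
  classical
  letI : NormedAlgebra ℚ (Matrix n n ℂ) := NormedAlgebra.restrictScalars ℚ ℂ _
  set s : Set (ι → Matrix.specialUnitaryGroup n ℂ) :=
    {W | ∀ i, ‖(W i : Matrix n n ℂ) - 1‖ < deltaSU n} with hs_def
  have hco : ∀ i, Continuous fun W : ι → Matrix.specialUnitaryGroup n ℂ => (W i : Matrix n n ℂ) - 1 := fun i =>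
    (continuous_subtype_val.comp (continuous_apply i)).sub continuous_const
  have hs_open : IsOpen s := by
    rw [hs_def, Set.setOf_forall]
    exact isOpen_iInter_of_finite fun i => isOpen_lt (hco i).norm continuous_const
  have hcont : ContinuousOn (ESU : (ι → Matrix.specialUnitaryGroup n ℂ) → Matrix.specialUnitaryGroup n ℂ) s := by
    refine Topology.IsInducing.subtypeVal.continuousOn_iff.2 ?_
    have hlog : ∀ i, ContinuousOn (fun W : ι → Matrix.specialUnitaryGroup n ℂ => mlog (W i : Matrix n n ℂ)) s :=
      fun i => continuousOn_logOnePlus_comp (hco i).continuousOn fun W hW =>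
        (lt_third_of_lt_deltaSU (hW i)).trans (by norm_num)
    have hexp : ContinuousOn (fun W : ι → Matrix.specialUnitaryGroup n ℂ =>
        exp (((Fintype.card ι : ℂ))⁻¹ • ∑ i, mlog (W i : Matrix n n ℂ))) s :=
      exp_continuous.comp_continuousOn ((continuousOn_finsetSum Finset.univ fun i _ => hlog i).fun_const_smul _)
    refine hexp.congr fun W hW => ?_
    show ((ESU W : Matrix.specialUnitaryGroup n ℂ) : Matrix n n ℂ) = _
    rw [coe_ESU_of_small hW, eml_eq_exp]
  have hcont' : ContinuousOn
      (ESU : (ι → Matrix.specialUnitaryGroup n ℂ) → Matrix.specialUnitaryGroup n ℂ) sᶜ :=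
    continuousOn_const.congr fun W hW => ESU_of_not_small hW
  have hpw := ContinuousOn.measurable_piecewise hcont hcont' hs_open.measurableSet
  rwa [Set.piecewise_same] at hpw

/-- **The printed small-loop average on `SU(N)`** as an inhabitant of `LoopAverage SU(N)`: radius
`δ_N = min(1/3, π/N)`, `E W = exp[i Σ_i |I|⁻¹ (1/i) log W_i]` on `∀ i, ‖W_i − 1‖ < δ_N` (value `1` off it), the axioms
(0.5), (0.6) (conjugations), (0.7) PROVED.  In the model `dist1 W = ‖W − 1‖` (`UnitaryModel` §4, `rfl`).
[cite: Balaban1987RG1, (0.4)–(0.7) p.253] -/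
def expMeanLogSU : LoopAverage (Matrix.specialUnitaryGroup n ℂ) where
  δ := deltaSU n
  δ_pos := deltaSU_pos
  E := fun W => ESU W
  inv := fun _ hW => ESU_inv hW
  conj := fun _ hW u => ESU_conj hW u
  perm := fun W _ σ => ESU_perm W σ

/-- The radius of `expMeanLogSU` is `min(1/3, π/N)`. [folklore] -/
theorem expMeanLogSU_δ : (expMeanLogSU (n := n)).δ = min (1 / 3) (Real.pi / Fintype.card n) := rfl

/-- On the guard `∀ i, dist1 W_i < δ_N`, `expMeanLogSU.E W` is the printed `exp[i Σ_i |I|⁻¹ (1/i) log W_i]`.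
[cite: Balaban1987RG1, (0.4) p.253] -/
theorem coe_expMeanLogSU_E {m : ℕ} (W : Fin (m + 1) → Matrix.specialUnitaryGroup n ℂ)
    (hW : ∀ i, dist1 (W i) < deltaSU n) :
    (((expMeanLogSU (n := n)).E W : Matrix.specialUnitaryGroup n ℂ) : Matrix n n ℂ) =
      exp (Complex.I • ∑ i, ((m + 1 : ℕ) : ℝ)⁻¹ • ((Complex.I⁻¹ : ℂ) • mlog (W i : Matrix n n ℂ))) := by
  show ((ESU W : Matrix.specialUnitaryGroup n ℂ) : Matrix n n ℂ) = _
  rw [coe_ESU_of_small hW, eml_def, Fintype.card_fin]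

/-- `SU(N) ⊆ U(N)`: an element of `SU(N)` as a unitary of `M_N(ℂ)`. [folklore] -/
def toUnitary (U : Matrix.specialUnitaryGroup n ℂ) : Matrix.unitaryGroup n ℂ :=
  ⟨U, Matrix.specialUnitaryGroup_le_unitaryGroup U.2⟩

omit [Nonempty n] in
/-- `toUnitary` does not change the matrix. [folklore] -/
theorem coe_toUnitary (U : Matrix.specialUnitaryGroup n ℂ) :
    ((toUnitary U : Matrix.unitaryGroup n ℂ) : Matrix n n ℂ) = (U : Matrix n n ℂ) := rfl

/-- **PRINCIPAL-LOGARITHM FORM** on `SU(N)`: on the guard, `expMeanLogSU.E W = exp[Σ_i |I|⁻¹ log W_i]` with `log` the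
principal logarithm (23), `log W_i = i·arg(W_i)` (§2b; `min(1/3, π/N) ≤ 1/3 < 2 ln 2/π`). [cite: Balaban1987RG1, (0.4) p.253] -/
theorem coe_expMeanLogSU_E_eq_exp_mean_arg {m : ℕ} (W : Fin (m + 1) → Matrix.specialUnitaryGroup n ℂ)
    (hW : ∀ i, dist1 (W i) < deltaSU n) :
    letI : CStarAlgebra (Matrix n n ℂ) := {}
    (((expMeanLogSU (n := n)).E W : Matrix.specialUnitaryGroup n ℂ) : Matrix n n ℂ) =
      exp (∑ i, ((m + 1 : ℕ) : ℝ)⁻¹ • (Complex.I • (Unitary.argSelfAdjoint (toUnitary (W i)) : Matrix n n ℂ))) := by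
  letI : CStarAlgebra (Matrix n n ℂ) := {}
  show ((ESU W : Matrix.specialUnitaryGroup n ℂ) : Matrix n n ℂ) = _
  rw [coe_ESU_of_small hW, eml_eq_exp_sum, Fintype.card_fin]
  congr 1
  refine Finset.sum_congr rfl fun i _ => ?_
  rw [← coe_toUnitary (W i), mlog_coe_unitary_eq_I_smul_arg
    ((lt_third_of_lt_deltaSU (hW i)).trans one_third_lt_two_log_two_div_pi)]

/-- `expMeanLogSU.E` is Borel measurable at every arity. [folklore] -/
theorem measurable_expMeanLogSU_E (m : ℕ) :
    Measurable fun W : Fin (m + 1) → Matrix.specialUnitaryGroup n ℂ => (expMeanLogSU (n := n)).E W :=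
  measurable_ESU

end SUN

/-! ## 6. The discharge (H-avg) of cell objection G-adv2-25 REPAIR (i), and consequences for the T4 programme -/

section Discharge

variable [Nonempty n]

/-- **(H-avg) on `U(N)`**, in the shape asked for by the cell objection G-adv2-25 REPAIR (i) ("principal log on the
group"): there is a loop average `ℰ₀` and a radius `δ₀ > 0` such that `ℰ₀.E` is measurable at every arity and, on every
family with all `dist1 W_i < δ₀`, `ℰ₀.E W = exp[Σ_i |I|⁻¹ log W_i]` with `log W_i = i·arg(W_i)` the principal logarithm (23)
— witnessed by `expMeanLogU`, `δ₀ = 1/3`. [cite: Balaban1987RG1, (0.4) p.253] -/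
theorem hAvg_unitaryGroup :
    letI : CStarAlgebra (Matrix n n ℂ) := {}
    ∃ ℰ₀ : LoopAverage (Matrix.unitaryGroup n ℂ), ∃ δ₀ : ℝ, 0 < δ₀ ∧
      (∀ m : ℕ, Measurable fun W : Fin (m + 1) → Matrix.unitaryGroup n ℂ => ℰ₀.E W) ∧
      ∀ (m : ℕ) (W : Fin (m + 1) → Matrix.unitaryGroup n ℂ), (∀ i, dist1 (W i) < δ₀) →
        ((ℰ₀.E W : Matrix.unitaryGroup n ℂ) : Matrix n n ℂ) =
          exp (∑ i, ((m + 1 : ℕ) : ℝ)⁻¹ • (Complex.I • (Unitary.argSelfAdjoint (W i) : Matrix n n ℂ))) :=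
  ⟨expMeanLogU, 1 / 3, by norm_num, measurable_expMeanLogU_E, fun _ W hW => coe_expMeanLogU_E_eq_exp_mean_arg W hW⟩

/-- **(H-avg) on `U(N)`, series form**: the same with the value written as print writes (0.4),
`exp[i Σ_i |I|⁻¹ (1/i) log W_i]`, `log` = the series (21). [cite: Balaban1987RG1, (0.4) p.253] -/
theorem hAvg_unitaryGroup_series :
    ∃ ℰ₀ : LoopAverage (Matrix.unitaryGroup n ℂ), ∃ δ₀ : ℝ, 0 < δ₀ ∧
      (∀ m : ℕ, Measurable fun W : Fin (m + 1) → Matrix.unitaryGroup n ℂ => ℰ₀.E W) ∧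
      ∀ (m : ℕ) (W : Fin (m + 1) → Matrix.unitaryGroup n ℂ), (∀ i, dist1 (W i) < δ₀) →
        ((ℰ₀.E W : Matrix.unitaryGroup n ℂ) : Matrix n n ℂ) =
          exp (Complex.I • ∑ i, ((m + 1 : ℕ) : ℝ)⁻¹ • ((Complex.I⁻¹ : ℂ) • mlog (W i : Matrix n n ℂ))) :=
  ⟨expMeanLogU, 1 / 3, by norm_num, measurable_expMeanLogU_E, fun _ W hW => coe_expMeanLogU_E W hW⟩

/-- **(H-avg) on `SU(N)`** (principal logarithm) — witnessed by `expMeanLogSU`, `δ₀ = min(1/3, π/N)`.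
[cite: Balaban1987RG1, (0.4) p.253] -/
theorem hAvg_specialUnitaryGroup :
    letI : CStarAlgebra (Matrix n n ℂ) := {}
    ∃ ℰ₀ : LoopAverage (Matrix.specialUnitaryGroup n ℂ), ∃ δ₀ : ℝ, 0 < δ₀ ∧
      (∀ m : ℕ, Measurable fun W : Fin (m + 1) → Matrix.specialUnitaryGroup n ℂ => ℰ₀.E W) ∧
      ∀ (m : ℕ) (W : Fin (m + 1) → Matrix.specialUnitaryGroup n ℂ), (∀ i, dist1 (W i) < δ₀) →
        ((ℰ₀.E W : Matrix.specialUnitaryGroup n ℂ) : Matrix n n ℂ) =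
          exp (∑ i, ((m + 1 : ℕ) : ℝ)⁻¹ • (Complex.I • (Unitary.argSelfAdjoint (toUnitary (W i)) : Matrix n n ℂ))) :=
  ⟨expMeanLogSU, deltaSU n, deltaSU_pos, measurable_expMeanLogSU_E,
    fun _ W hW => coe_expMeanLogSU_E_eq_exp_mean_arg W hW⟩

/-- **(H-avg) on `SU(N)`, series form** (the value as print writes (0.4)). [cite: Balaban1987RG1, (0.4) p.253] -/
theorem hAvg_specialUnitaryGroup_series :
    ∃ ℰ₀ : LoopAverage (Matrix.specialUnitaryGroup n ℂ), ∃ δ₀ : ℝ, 0 < δ₀ ∧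
      (∀ m : ℕ, Measurable fun W : Fin (m + 1) → Matrix.specialUnitaryGroup n ℂ => ℰ₀.E W) ∧
      ∀ (m : ℕ) (W : Fin (m + 1) → Matrix.specialUnitaryGroup n ℂ), (∀ i, dist1 (W i) < δ₀) →
        ((ℰ₀.E W : Matrix.specialUnitaryGroup n ℂ) : Matrix n n ℂ) =
          exp (Complex.I • ∑ i, ((m + 1 : ℕ) : ℝ)⁻¹ • ((Complex.I⁻¹ : ℂ) • mlog (W i : Matrix n n ℂ))) :=
  ⟨expMeanLogSU, deltaSU n, deltaSU_pos, measurable_expMeanLogSU_E, fun _ W hW => coe_expMeanLogSU_E W hW⟩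

end Discharge

end Matrices

/-! ## 7. (v1.1) The two properties print asks of `M` before (0.5): ANALYTICITY and `Gᶜ`-valuedness of the printed
operation ([Balaban1987RG1] p. 253: "It is a `Gᶜ`-valued function defined on sets `{U_j : j = 1, 2, …, n}`, `U_j ∈ Gᶜ`,
with sufficiently small diameters. … and we assume that it is an analytic function having the following properties")

Everything in this section is a kernel-checked [folklore] fact about the explicit operation `eml W = exp(|I|⁻¹ Σ_i log W_i)`
of §2; print is cited as the locator of the statement SHAPE only (the paper ASSUMES these properties of its axiomatic `M`;
here they are PROVED for the operation (0.4) prints).  The analyticity is the joint complex analyticity of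
`eml : (I → 𝔸) → 𝔸` between complex Banach spaces (`I → 𝔸` with the sup norm) at every family all of whose members lie
in the open unit ball around `1` — the natural domain of the series logarithm (21) — which contains every guard used in
§4–§6 (`1/3`, `min(1/3, π/N)`). -/

section Analytic

open Literature.Analysis.Complex (analyticAt_logOnePlus)

variable {𝔸 : Type*} [NormedRing 𝔸] [NormedAlgebra ℂ 𝔸] [CompleteSpace 𝔸]

/-- The series logarithm (21) is complex-analytic at every `X` with `‖X − 1‖ < 1` (the tree's `analyticAt_logOnePlus`
composed with the translation `X ↦ X − 1`). [folklore] -/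
theorem analyticAt_mlog {X : 𝔸} (hX : ‖X - 1‖ < 1) : AnalyticAt ℂ (mlog : 𝔸 → 𝔸) X := by
  have h : (mlog : 𝔸 → 𝔸) = fun Y => logOnePlus (Y - 1) := funext fun Y => mlog_def Y
  have h1 : AnalyticAt ℂ (fun Y : 𝔸 => Y - 1) X := analyticAt_id.fun_sub analyticAt_const
  rw [h]
  exact (analyticAt_logOnePlus hX).fun_comp_of_eq h1 rfl

variable {ι : Type*} [Fintype ι]

/-- The set of `δ`-SMALL FAMILIES `{W : I → 𝔸 | ∀ i, ‖W_i − 1‖ < δ}` — print's "sets … with sufficiently small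
diameters", based at `1` (the guards of §4–§5 are `smallFamilies _ _ (1/3)` and `smallFamilies _ _ (deltaSU n)` read
through the inclusion of the group in `M_N(ℂ)`). [cite: Balaban1987RG1, before (0.5) p.253] -/
def smallFamilies (ι 𝔸 : Type*) [NormedRing 𝔸] (δ : ℝ) : Set (ι → 𝔸) := {W | ∀ i, ‖W i - 1‖ < δ}

omit [NormedAlgebra ℂ 𝔸] [CompleteSpace 𝔸] [Fintype ι] in
/-- Membership in the set of `δ`-small families, unfolded. [folklore] -/
theorem mem_smallFamilies {δ : ℝ} {W : ι → 𝔸} : W ∈ smallFamilies ι 𝔸 δ ↔ ∀ i, ‖W i - 1‖ < δ := Iff.rfl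

omit [NormedAlgebra ℂ 𝔸] [CompleteSpace 𝔸] in
/-- The set of `δ`-small families is OPEN (a finite intersection of preimages of open balls under the continuous
coordinate maps). [folklore] -/
theorem isOpen_smallFamilies (δ : ℝ) : IsOpen (smallFamilies ι 𝔸 δ) := by
  have h : smallFamilies ι 𝔸 δ = ⋂ i, (fun W : ι → 𝔸 => ‖W i - 1‖) ⁻¹' Set.Iio δ := by
    ext W; simp [smallFamilies]
  rw [h]
  exact isOpen_iInter_of_finite fun i =>
    (((continuous_apply i).sub continuous_const).norm).isOpen_preimage _ isOpen_Iio

omit [NormedAlgebra ℂ 𝔸] [CompleteSpace 𝔸] [Fintype ι] in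
/-- Monotonicity of the set of small families in the radius. [folklore] -/
theorem smallFamilies_mono {δ δ' : ℝ} (h : δ ≤ δ') : smallFamilies ι 𝔸 δ ⊆ smallFamilies ι 𝔸 δ' :=
  fun _ hW i => (hW i).trans_le h

/-- **ANALYTICITY OF THE PRINTED OPERATION** ([Balaban1987RG1] p. 253 "we assume that it is an analytic function",
here PROVED for the operation (0.4) prints): `W ↦ eml W = exp(|I|⁻¹ Σ_i log W_i)` is complex-analytic, as a map
`(I → 𝔸) → 𝔸` of complex Banach spaces, at every family with `‖W_i − 1‖ < 1` for all `i` — the coordinate projections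
are continuous linear (`ContinuousLinearMap.proj`), the series logarithm is analytic there (`analyticAt_mlog`), finite
sums and scalar multiples of analytic maps are analytic, and `exp` is entire (`NormedSpace.exp_analytic`).
[cite: Balaban1987RG1, before (0.5) p.253] -/
theorem analyticAt_eml {W : ι → 𝔸} (hW : ∀ i, ‖W i - 1‖ < 1) : AnalyticAt ℂ (eml : (ι → 𝔸) → 𝔸) W := by
  have h : (eml : (ι → 𝔸) → 𝔸) = fun W => exp (((Fintype.card ι : ℂ))⁻¹ • ∑ i, mlog (W i)) :=
    funext fun W => eml_eq_exp W
  rw [h]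
  have hproj : ∀ i, AnalyticAt ℂ (fun W : ι → 𝔸 => W i) W := fun i =>
    (ContinuousLinearMap.proj (R := ℂ) (φ := fun _ : ι => 𝔸) i).analyticAt W
  have hterm : ∀ i, AnalyticAt ℂ (fun W : ι → 𝔸 => mlog (W i)) W := fun i =>
    (analyticAt_mlog (hW i)).fun_comp_of_eq (hproj i) rfl
  have hsum : AnalyticAt ℂ (fun W : ι → 𝔸 => ∑ i, mlog (W i)) W :=
    Finset.analyticAt_fun_sum Finset.univ fun i _ => hterm i
  have hsmul : AnalyticAt ℂ (fun W : ι → 𝔸 => ((Fintype.card ι : ℂ))⁻¹ • ∑ i, mlog (W i)) W :=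
    hsum.fun_const_smul
  exact (exp_analytic _).fun_comp_of_eq hsmul rfl

/-- The printed operation is analytic on a neighbourhood of every point of the open set of `1`-small families.
[folklore] -/
theorem analyticOnNhd_eml : AnalyticOnNhd ℂ (eml : (ι → 𝔸) → 𝔸) (smallFamilies ι 𝔸 1) :=
  fun _ hW => analyticAt_eml hW

/-- … in particular on every set of `δ`-small families with `δ ≤ 1` (the guards `1/3` of §4 and `min(1/3, π/N)` of §5).
[folklore] -/
theorem analyticOnNhd_eml_of_le_one {δ : ℝ} (hδ : δ ≤ 1) : AnalyticOnNhd ℂ (eml : (ι → 𝔸) → 𝔸) (smallFamilies ι 𝔸 δ) :=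
  analyticOnNhd_eml.mono (smallFamilies_mono hδ)

/-- Hence complex-(Fréchet-)differentiable at every `1`-small family. [folklore] -/
theorem differentiableAt_eml {W : ι → 𝔸} (hW : ∀ i, ‖W i - 1‖ < 1) :
    DifferentiableAt ℂ (eml : (ι → 𝔸) → 𝔸) W :=
  (analyticAt_eml hW).differentiableAt

/-- Hence `C^∞` (indeed `C^ω`) over `ℂ` on the open set of `1`-small families. [folklore] -/
theorem contDiffOn_eml : ContDiffOn ℂ ⊤ (eml : (ι → 𝔸) → 𝔸) (smallFamilies ι 𝔸 1) :=
  analyticOnNhd_eml.contDiffOn_of_completeSpace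

/-- Hence continuous at every `1`-small family (the continuity on the guard that the measurability proofs of §4–§5
establish by hand). [folklore] -/
theorem continuousAt_eml {W : ι → 𝔸} (hW : ∀ i, ‖W i - 1‖ < 1) : ContinuousAt (eml : (ι → 𝔸) → 𝔸) W :=
  (analyticAt_eml hW).continuousAt

/-- **`Gᶜ`-VALUEDNESS for `G = U(N)` (`Gᶜ = GL(N, ℂ)`), in any complete normed `ℂ`-algebra**: the printed operation takes
INVERTIBLE values on every family whatsoever — it is an exponential ([Balaban1987RG1] p. 253 "It is a `Gᶜ`-valued
function"). [cite: Balaban1987RG1, before (0.5) p.253] -/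
theorem isUnit_eml (W : ι → 𝔸) : IsUnit (eml W) := by
  letI : NormedAlgebra ℚ 𝔸 := NormedAlgebra.restrictScalars ℚ ℂ 𝔸
  rw [eml_eq_exp]
  exact isUnit_exp _

end Analytic

section MatricesGc

open scoped Matrix.Norms.L2Operator

variable {n : Type*} [Fintype n] [DecidableEq n]

/-- `tr log W = 0` for every matrix `W` with `det W = 1`, `‖W − 1‖ ≤ 1/3` and `N‖W − 1‖ < π`: the proof of
`trace_mlog_eq_zero` (§3) uses of `W ∈ SU(N)` only `det W = 1`, so it holds verbatim on the complexification
`Gᶜ = SL(N, ℂ)` — `e^{tr log W} = det e^{log W} = det W = 1` (Liouville) and `|tr log W| ≤ N‖log W‖ ≤ 2N‖W − 1‖ < 2π`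
((20), (26)). [folklore] -/
theorem trace_mlog_eq_zero_of_det_eq_one {X : Matrix n n ℂ} (hX : X.det = 1)
    (hs : ‖X - 1‖ ≤ 1 / 3) (hπ : Fintype.card n * ‖X - 1‖ < Real.pi) : (mlog X).trace = 0 := by
  have hX1 : ‖X - 1‖ < 1 := lt_of_le_of_lt hs (by norm_num)
  have hexp : Complex.exp (mlog X).trace = 1 := by
    rw [Complex.exp_eq_exp_ℂ, ← det_exp_eq_exp_trace, exp_mlog hX1]
    exact hX
  obtain ⟨k, hk⟩ := Complex.exp_eq_one_iff.1 hexp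
  have hbd : ‖(mlog X).trace‖ < 2 * Real.pi := by
    have h1 : ‖(mlog X).trace‖ ≤ Fintype.card n * ‖mlog X‖ := by
      rcases isEmpty_or_nonempty n with hn | hn
      · simp [Matrix.trace]
      have hc : (0 : ℝ) < Fintype.card n := Nat.cast_pos.mpr Fintype.card_pos
      have h : ‖(mlog X).trace / (Fintype.card n : ℂ)‖ ≤ ‖mlog X‖ := MatrixNorms.norm_ntr_le_opNorm (mlog X)
      rw [norm_div, Complex.norm_natCast, div_le_iff₀ hc] at h
      linarith [mul_comm (Fintype.card n : ℝ) ‖mlog X‖]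
    have h2 : ‖mlog X‖ ≤ 2 * ‖X - 1‖ := norm_mlog_le_two_mul (hs.trans (by norm_num))
    have hc : (0 : ℝ) ≤ Fintype.card n := Nat.cast_nonneg _
    nlinarith [mul_le_mul_of_nonneg_left h2 hc]
  have hk0 : k = 0 := by
    have h2π : ‖(k : ℂ) * (2 * Real.pi * Complex.I)‖ < 2 * Real.pi := by rw [← hk]; exact hbd
    have hn : ‖(2 * Real.pi * Complex.I : ℂ)‖ = 2 * Real.pi := by
      simp [abs_of_pos Real.pi_pos]
    rw [norm_mul, hn, Complex.norm_intCast] at h2π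
    have hk1 : |(k : ℝ)| < 1 := (mul_lt_iff_lt_one_left (by positivity)).1 h2π
    have : |k| < 1 := by exact_mod_cast hk1
    exact Int.abs_lt_one_iff.1 this
  rw [hk, hk0]
  simp

/-- **`Gᶜ`-VALUEDNESS for `G = SU(N)` (`Gᶜ = SL(N, ℂ)`)**: for matrices `W_i` with `det W_i = 1`, `‖W_i − 1‖ ≤ 1/3` and
`N‖W_i − 1‖ < π` (the guard of `expMeanLogSU`, read on the complexification) the printed operation has determinant
`1`: `det eml = e^{|I|⁻¹ Σ_i tr log W_i} = e^0 = 1`.  Together with `isUnit_eml` this is print's "`Gᶜ`-valued function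
defined on sets `{U_j}`, `U_j ∈ Gᶜ`, with sufficiently small diameters" for the exp-mean-log operation near `1`.
[cite: Balaban1987RG1, before (0.5) p.253] -/
theorem det_eml_eq_one {ι : Type*} [Fintype ι] {W : ι → Matrix n n ℂ} (hW : ∀ i, (W i).det = 1)
    (hs : ∀ i, ‖W i - 1‖ ≤ 1 / 3) (hπ : ∀ i, Fintype.card n * ‖W i - 1‖ < Real.pi) : (eml W).det = 1 := by
  rw [eml_eq_exp, det_exp_eq_exp_trace, Matrix.trace_smul, Matrix.trace_sum,
    Finset.sum_eq_zero fun i _ => trace_mlog_eq_zero_of_det_eq_one (hW i) (hs i) (hπ i), smul_zero, exp_zero]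

/-- The guarded inhabitant of §4 is CONTINUOUS on its open guard as an `M_N(ℂ)`-valued map of the family: there `EU`
is the analytic `eml` composed with the inclusion `U(N) ⊂ M_N(ℂ)`. [folklore] -/
theorem continuousOn_coe_EU {ι : Type*} [Fintype ι] :
    ContinuousOn (fun W : ι → Matrix.unitaryGroup n ℂ => ((EU W : Matrix.unitaryGroup n ℂ) : Matrix n n ℂ))
      {W | ∀ i, ‖(W i : Matrix n n ℂ) - 1‖ < 1 / 3} := by
  intro W hW
  have hW1 : ∀ i, ‖(W i : Matrix n n ℂ) - 1‖ < 1 := fun i => (hW i).trans (by norm_num)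
  have hcoe : Continuous fun W : ι → Matrix.unitaryGroup n ℂ => fun i => (W i : Matrix n n ℂ) :=
    continuous_pi fun i => continuous_subtype_val.comp (continuous_apply i)
  have hc : ContinuousAt (fun W : ι → Matrix.unitaryGroup n ℂ => eml fun i => (W i : Matrix n n ℂ)) W :=
    (continuousAt_eml hW1).comp hcoe.continuousAt
  exact hc.continuousWithinAt.congr (fun W' hW' => coe_EU_of_small hW') (coe_EU_of_small hW)

/-- The guarded inhabitant of §5 is CONTINUOUS on its open guard as an `M_N(ℂ)`-valued map of the family: there `ESU`
is the analytic `eml` composed with the inclusion `SU(N) ⊂ M_N(ℂ)`. [folklore] -/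
theorem continuousOn_coe_ESU [Nonempty n] {ι : Type*} [Fintype ι] :
    ContinuousOn (fun W : ι → Matrix.specialUnitaryGroup n ℂ =>
        ((ESU W : Matrix.specialUnitaryGroup n ℂ) : Matrix n n ℂ))
      {W | ∀ i, ‖(W i : Matrix n n ℂ) - 1‖ < deltaSU n} := by
  intro W hW
  have hW1 : ∀ i, ‖(W i : Matrix n n ℂ) - 1‖ < 1 := fun i => (lt_third_of_lt_deltaSU (hW i)).trans (by norm_num)
  have hcoe : Continuous fun W : ι → Matrix.specialUnitaryGroup n ℂ => fun i => (W i : Matrix n n ℂ) :=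
    continuous_pi fun i => continuous_subtype_val.comp (continuous_apply i)
  have hc : ContinuousAt (fun W : ι → Matrix.specialUnitaryGroup n ℂ => eml fun i => (W i : Matrix n n ℂ)) W :=
    (continuousAt_eml hW1).comp hcoe.continuousAt
  exact hc.continuousWithinAt.congr (fun W' hW' => coe_ESU_of_small hW') (coe_ESU_of_small hW)

end MatricesGc

end ExpMeanLog

/-! ### Consequences for finite-`ε` data on `SU(N)` block-averaged by the printed operation -/

namespace T4Continuum.FiniteEpsData

open ExpMeanLog

variable {F : T4Family} {N : ℕ} [NeZero N]

/-- **`AvgMeasurable` WITH NO RESIDUAL HYPOTHESIS** for finite-`ε` data on `SU(N)` whose averaging maps are Bałaban's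
block averaging (0.4) driven by the PRINTED small-loop average. [cite: Balaban1987RG1, (0.4) p.253] -/
theorem avgMeasurable_of_blockAvgEML (D : FiniteEpsData F (Matrix.specialUnitaryGroup (Fin N) ℂ))
    (h : ∀ K j, D.av K j = BlockAveraging.blockAvg expMeanLogSU) : D.AvgMeasurable :=
  D.avgMeasurable_of_blockAvg expMeanLogSU measurable_expMeanLogSU_E h

/-- Hence the REFLECTION-POSITIVITY and TORUS-COVARIANCE targets of rung (B)+1 HOLD, in both forms, for such data
(`T4Continuum.avg_limit_reflectionPositive_SU` + `BlockAveraging.limit_torusCovariant_of_blockAvg`).  WHAT IS USED: the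
printed average (0.4) with its conjugation covariance (0.6) (through `expMeanLogSU` and the two tree lemmas just named);
B12 Theorem 2 p. 259 (the statement the cell records as printed-but-unproved, whose regime the rung-(B)+1 targets refer
to) is CONTEXT ONLY and is NOT used (cell GAPS G-ref2-24 (c); v1.0.1 retag).
[cite: Balaban1987RG1, (0.4)/(0.6) p.253] -/
theorem limit_rp_and_cov_of_blockAvgEML (D : FiniteEpsData F (Matrix.specialUnitaryGroup (Fin N) ℂ))
    (h : ∀ K j, D.av K j = BlockAveraging.blockAvg expMeanLogSU) :
    (D.limit_reflectionPositive' ∧ D.limit_reflectionPositive) ∧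
      (D.limit_torusCovariant' ∧ D.limit_torusCovariant) :=
  ⟨D.avg_limit_reflectionPositive_SU (D.avgMeasurable_of_blockAvgEML h),
    D.limit_torusCovariant_of_blockAvg expMeanLogSU h⟩

/-- And the FOUR print-faithful targets for such data follow from the EXISTENCE target alone.  WHAT IS USED: the
printed average (0.4)/(0.6) p. 253 (previous theorem) and `limit_unique'_of_limit_exists'`; B12 Theorem 2 p. 259 is
CONTEXT ONLY (the regime the targets refer to) and is NOT used (cell GAPS G-ref2-24 (c); v1.0.1 retag).
[cite: Balaban1987RG1, (0.4)/(0.6) p.253] -/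
theorem four_targets_of_exists_blockAvgEML (D : FiniteEpsData F (Matrix.specialUnitaryGroup (Fin N) ℂ))
    (h : ∀ K j, D.av K j = BlockAveraging.blockAvg expMeanLogSU)
    (hex : D.ym4_torus_continuum_limit_exists') :
    D.ym4_torus_continuum_limit_exists' ∧ D.ym4_torus_continuum_limit_unique' ∧
      D.limit_reflectionPositive' ∧ D.limit_torusCovariant' :=
  ⟨hex, D.limit_unique'_of_limit_exists' hex, (D.limit_rp_and_cov_of_blockAvgEML h).1.1,
    (D.limit_rp_and_cov_of_blockAvgEML h).2.1⟩

end T4Continuum.FiniteEpsData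

end Literature.MathematicalPhysics.QuantumFieldTheory.Balaban1983to89
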